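import Summits.AnomalousDissipation.AnomalousDissipation.Theses.MomentParity
import Literature.Analysis.FluidPDE.StatisticalSolutionProofs
import Literature.Analysis.FluidPDE.StatisticalSolutionEnergyEq
import Literature.Analysis.FluidPDE.StatisticalSolutionDirac
import Literature.Analysis.FluidPDE.CylindricalGenerator
import Literature.Analysis.FunctionSpaces.TorusSpectralWeakDerivative
import Literature.Analysis.FunctionSpaces.TorusFourierModes
import Literature.Analysis.FunctionSpaces.TorusFourierCalculus
import Literature.Analysis.FunctionSpaces.TorusFluidGlueProofs
import Literature.Analysis.FunctionSpaces.TorusCalculusProofs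
import Literature.Analysis.FluidPDE.BeltramiWavesCurl
import Literature.Analysis.FluidPDE.NSGalerkinFourier

/-!
# Disproof of `QuarticGate` — findings of the standing adversary (cdisprove, stmt-AnomalousDissipation-11464)

Crux: `Summit.AnomalousDissipation.AnomalousDissipation.Theses.MomentParity.QuarticGate` (route
MomentParity, rank 2): `∃ f` smooth div-free mean-zero, `ν_j → 0`, `E`, `ε > 0`, `∀ j ∃ᶠ N ∃ μ`
probability on `H`, level-`N` carried, `∫‖u‖⁴ < ∞`, 4-STATIONARY (rows of all polynomial cylindrical
tests of total degree `≤ 3` with level-`N` band tests vanish), `ensembleEnergy μ ≤ E`,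
`ε ≤ ensembleDissipation ν_j μ`. Restated definitionally as `quarticGate_iff` over the named clauses
`IsLevel / IsBandTest / polyGrad / IsPolyStationary / IsQuarticWitness` (same names as
`Cruxes/QuarticGate/Ideate1Sketch.lean`).

## Verdict so far: NO KILL — and why it resists

* An `∃`-crux is killed only by a UNIVERSAL quietness theorem: "for every force, along every
  `ν_j → 0`, frequently-in-`N` level-`N` 4-stationary laws of energy `≤ E` have dissipation `→ 0`".
  Since `QuarticGate ⇒` its order-3 shadow (3-stationary, same budgets), the cheapest conceivable
  kill is already a kill of the ORDER-3 tier, i.e. a quadratic-Casimir / background-type quietness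
  certificate for 3-D Galerkin NS uniform in `N` — none exists (3-D: the quadratic Casimirs of the
  ball truncation are `span{E, H}` numerically up to 728 modes, `H` indefinite; the 2-D analogue IS
  such a certificate: enstrophy, `PlanarCubicQuiet`). So a substantive refutation = "no Galerkin
  ensemble zeroth law at SOS degree 4, uniformly in N": open, believed false (DNS).
* As TYPED the crux is WEAKER than the card's quasi-normal gate: the fourth moment is not normalised
  before `∀ j` (only `Integrable ‖u‖^4`), so cubic rows can be absorbed by far antipodal atoms
  (recession directions of the degree-4 moment cone) — line `recession-cone` (PICKED). Every attack
  on order-4 POSITIVITY (the card's "why it might fail") is therefore moot for the typed statement;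
  only the order-≤2 design (mean rows + energy row + helicity row + loudness + `C ≻ 0`) and the
  Casimir classification carry truth content, and I find no obstruction to either (explicit
  two-mode Kolmogorov design re-derived independently: stress of one circularly-symmetric correlated
  pair `(0,0,K),(0,1,K)`, `a = e₁`, `b ∝ (0,K,−1)`, gives `P div R ∥ f`, energy `O(1)`,
  `K ≍ ν^{-1/2}`, helicity row void; N-independent for `N ≥ K + 2`).
* Barriers catalogue (`Literature/Barriers/AnomalousDissipation/*`): none bites a Galerkin-level
  measure construction (all continuum / 2-D / negative-proof barriers); negatives index
  (DebrisQuanta 2859, FrustratedForces 2979/2984) unrelated.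

## Cycle 2 (cdisprove g2, 2026-08-16) — additions, see sections F and G at the end of the file
* (F) `ν_j → 0` IS LOAD-BEARING (`quarticGateWithoutVanishingViscosity_holds`,
  `exists_loud_dirac_polyStationary_all_orders`): at fixed viscosity the laminar Dirac of (D) is a loud
  witness at every level `N ≥ 1` and every order `d`. The load-bearing table is now complete: each of
  `0 < ε`, `ensembleEnergy ≤ E`, `ν_j → 0`, unbounded `∃ᶠ N`, `∃ f` is necessary (B, D, F, A, C).
* (G) THE LEAD'S STUBS (line `recession-cone`, S1–S6): all six re-derived adversarially on paper — none is
  false as typed (S6's trigonometric bookkeeping re-checked independently: mean row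
  `(1 + πA₁B₂ − 4π²νU₀) f = 0`, energy row solvable by IVT in the window `K²ν ∈ [U₀/146, U₀/25]`,
  helicity row vanishes termwise incl. the noise trace `tr(Δ∘curl|V_N) = 0`; S5 true but needs the
  fattening + covering argument, not the bare `y_λ`; S3 = finite-dimensional cone duality, needs only
  that a convex cone with dense span and trivial dual is everything; S4 = Fialkow–Nie after an `O(R⁻²)`
  perturbation of a strictly positive functional on a compact base). The line's only conjectural content
  is S2 = `∃ᶠ N, NoCubicCasimir N ∧ QuadRigidity N` (named below); EXACT COMPUTATION (mod-p rank of the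
  momentum-graded invariance systems, `casimir/main.py`, kit jobs listed in §G): quadratic Casimirs of the
  ball truncation `0<|k|²≤M` are EXACTLY `span{E,H}` for `M = 3,4,5,6,8,9` (typed levels `N = 2, 3`), cubic
  Casimirs are `0` for `M = 2,3` (larger `M` running); level `N = 1` has no triads (`B_1 ≡ 0`: S2 false
  there, harmless). VERDICT UNCHANGED: no kill; the crux as typed is very probably TRUE via the line.
* (H) LEVEL ONE IS INERT, FORMALLY (`nsGeneratorPairing_zero_zero_of_level_one`,
  `not_noCubicCasimir_one`, `not_quadRigidity_one`): `B_1 ≡ 0` (the unit ball carries no triad), the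
  cubic Casimir `(u,K_1)³` and the quadratic Casimir `(u,K_1)²` (gradient `2(u,K_1)K_1 ≠ 2αP_1u + 2β curl P_1u`)
  refute both conjuncts of S2 at `N = 1` — the strengthening "`∀ N ≥ 1`" of `stub_casimirs` is FALSE
  (sorry-free; landed as `Negative/LevelOne.lean` + `LevelOneQuad.lean`). Infrastructure: the Euler bracket of a level-`N` field
  against a band test in coefficients, `∫(u⊗u):∇w = Σ_{|k|≤N} Re⟪convectionCoeff û ŵ k, û k⟫` (general `N`).
* (I) THE HONEST GATE `C′ = QuarticGateSupported` (support bound `R(j)` before `∃ᶠ N`):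
  `MomentLadder → QuarticGateSupported → QuarticGate` (both proved); the typed crux is the target's `d = 4`
  rung with its support clause deleted, and that deletion is exactly what the line's far atoms use — recommended
  repair if the crux closes "for the wrong reason" (planner's call; see §I docstring).
* (J) THE MOMENTUM ROW (`force_sq_le_of_momentumRow`, `IsQuarticWitness.force_sq_le`): the single linear test
  `g = f` gives `‖f‖₂² ≤ ν‖Δf‖₂√E + C_f E` (`C_f = sup Σᵢ‖∂ᵢf‖`) for every law with vanishing linear rows and
  band-limited force — an `ε`-INDEPENDENT ENERGY FLOOR `E ≳ ‖f‖₂²/C_f` and, with (C), a turnover ceiling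
  `ε ≲ √C_f · E`; landed as `Negative/MomentumRow.lean` p78662.
* (K) THE SELECTION RULE, formally (`Negative/SelectionRule.lean`, pure vector algebra): equal-length pairs
  miss one polarisation and ONLY they do (block-killing lemma `eq_zero_of_forall_pair_transfer`).
LANDINGS (g2), all under `Theorems/QuarticGate/Negative/`: FixedViscosity p78653, LevelOne p78686,
MomentumRow p78662, SelectionRule p79020, LevelOneQuad p82396 (¬QuadRigidity 1) — ALL ACCEPTED.
PENDING COMPUTE (auto-attaches to the item): j011962 (M=4 re-validation), j011081 (quadratic M=25 = level 5),
j011084 (cubic M=6), j011086 (cubic M=9 = `NoCubicCasimir 3`) — fold into §G at the next arm.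

## What IS proved here (sorry-free; landed / to land under `Theorems/QuarticGate/Negative/`)

(A) LEVEL CEILING (`ensembleDissipation_le_of_level`, `IsQuarticWitness.eps_le`,
    `not_quarticGateBoundedLevel`): `ε ≤ 4π²N²ν_jE` for every witness; the natural strengthening
    with `N` chosen before `j` is FALSE. Any proof must let `N → ∞` at least like `ν_j^{-1/2}`.
(B) LOAD-BEARING `0 < ε` (`quarticGateWithoutEpsPos_holds`): drop it and `δ₀`, `f = 0` witnesses.
(C) ENERGY ROW / FORCE FLOOR (`energy_row_of_polyStationary`, `ensembleDissipation_eq_of_polyStationary`,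
    `ensembleDissipation_le_of_polyStationary`, `IsQuarticWitness.eps_le_force`, `not_quarticGateEveryForce`,
    `not_quarticGateSubFloor`): from the single quadratic test `Σ (u,g_kjc)²` over the level-`N` frame,
    every polynomially 3-stationary level-`N` law has `ν∫‖∇u‖² dμ = ∫(f,u) dμ` EXACTLY, hence
    `ε ≤ ‖f‖_{L²} √E`: the ∀-force strengthening is FALSE (`f = 0`), and `‖f‖₂√E < ε` is FALSE.
    Provers: your `E` must be `≥ (ε/‖f‖₂)²`; the dissipation of any witness IS `∫(f,u)dμ` (mean flow).
(D) LAMINAR KOLMOGOROV FAMILY (`kolField a = a cos(2πx₁)e₀`, `kolState`, `nsGeneratorPairing_kolField`,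
    `isPolyStationary_dirac_kolState`, `isQuarticWitness_dirac_kolState`,
    `quarticGateWithoutEnergyCeiling_holds`): `δ_{[K_a]}` with force `4π²νK_a` is stationary at
    EVERY order (exact steady state: `νΔK + f = 0`, `(K·∇)K = 0`), level 1; with `a = (4π²ν)⁻¹` it
    witnesses the fixed force `K_1` with dissipation `(8π²ν)⁻¹` and energy `a²/2`, ATTAINING the force
    floor of (C) (`‖K_1‖₂√E = (8π²ν)⁻¹`): (C) cannot be improved, and the energy ceiling is
    load-bearing (drop it and the laminar family witnesses the statement as `ν_j → 0`).

(E) SHAPE (`not_quarticGate_iff`, `CubicShadow`, `cubicShadow_of_quarticGate`): what a refutation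
    must prove (uniform-in-`N` quietness), and the order-3 shadow that any cheap kill would already kill.

## Sibling negative knowledge that transfers (order-3 shadow, `cubicShadow_of_quarticGate`)
`Theorems/CubicParityLoud/Negative/{Clauses,EnergyRow,LoadBearing}.lean` (cdisprove seat of
stmt-11465, landed): the same energy row and level ceiling (independently), plus: a witness does work
`∫(u,f)dμ ≥ ε`, hence is NOT symmetric under `u ↦ −u` (`IsWitness.map_neg_ne`) — every QuarticGate
witness has a non-zero mean flow correlated with `f`; forces doing no work on `H` (gradients, constants,
`f = 0`) never witness. The dual-side sibling `TaylorCertificates.TaylorCertificatePair` (stmt-13037) was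
REFUTED (`ledger negatives`): ν-uniform Taylor-resolved energy-weighted CEILING certificates do not exist —
consistent with the expectation that no cheap quietness certificate kills this (primal) crux.

## Load-bearing summary for the lead (every clause of the crux is necessary for non-triviality)
`0 < ε` (B: δ₀), `ensembleEnergy ≤ E` (D: laminar family), `ν_j → 0` (at fixed ν steady Galerkin
Diracs are loud: `exists_galerkinRHS_eq_zero` + the injection floor — not formalised here), `∃ᶠ N`
unbounded (A: bounded levels are quiet), `∃ f` (C: `f = 0` is quiet; need `‖f‖₂ ≥ ε/√E`).

## Attacks tried (details in NOTES.md of the cdisprove seat)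
degenerate forces (`f = 0`: dead by (C)); bounded / Taylor-window levels (dead by (A)); Gaussian
witnesses (no nondegenerate Gaussian is even 3-stationary: Stein, `E[(F,C⁻¹(u−ū))] = −ν tr Λ < 0`;
not formalised — Gaussian measures on `H`); absolutely continuous fully invariant laws (volume
contraction; irrelevant at finite `d`); order-4 positivity (moot as typed, see above); accidental
definite quadratic Casimir at large `N` (numerics on the item say no; would kill the order-3 tier).

## Targets (lead's stuck stubs): none posted (payload.targets = [] at g1 AND at g2, 2026-08-16T02:16Z).
g2 re-derived all six stubs adversarially (paper) and formally refuted the `∀ N ≥ 1` strengthening of S2 at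
`N = 1` (section H); exact computation supports S2 at `N = 2` (both conjuncts) and `N = 3` (quadratic half).
Pre-check of the lead's registered skeleton (sha b49af609…, `Lines/recession-cone.lean`, stubs S1–S6),
cheap-falsity pass only — NO STUB IS FALSE AS TYPED as far as cheap attacks reach:
* S1 `stub_signLemma`: true (isotropic level-`N` Gaussian is Galerkin–Euler invariant; `N ≤ 1` trivial).
* S2 `stub_casimirs` (`∃ᶠ N`): conjectural content; FALSE at `N = 1` (`B_1 ≡ 0`, every polynomial is a
  Casimir) — harmless for `∃ᶠ N`; numerics on the item: quadratic nullity 2, cubic 0 at level 2.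
* S3/S4: fine as typed. S5 `stub_order3Surgery`: its SLATER₄ conclusion (`0 < ∫P dμ₁` for every nonneg
  degree-≤4 `P` not vanishing on level-`N` fields) CANNOT be met by a finitely atomic `μ₁` with fewer than
  `≈ n_N²/2` atoms (`P = q²`, `q` a nonzero quadratic through the atoms) — realise the interior moment point
  by a law with a density / enough generic atoms, not by the bare Fialkow–Nie atoms. (A remark on the proof
  route, not a falsity.)
* S6 `stub_order2Design`: VERIFIED by hand (adversarially): θ-uniform phase kills the sum-frequency stress,
  the difference-frequency stress is `−πA₁B₂ sin(2πy)e₁ = −πA₁B₂ f` (with `A = A₁e₁ ⊥ (0,0,K)`,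
  `B = (0,B₂,−B₂/K) ⊥ (0,1,K)`), iid frame noise has constant stress (Parseval frame is translation
  invariant), so the linear rows read `(1 − 4π²νU₀ + πA₁B₂) f = 0`; energy row `ν E‖∇u‖² = U₀/2` by IVT;
  helicity row vanishes termwise (`a·(k×a) = 0`, distinct wavevectors orthogonal, `(f, curl f) = 0`);
  consistent with (A) (`N₀ = K+2`, `K ≍ ν^{-1/2}`) and (C) (`ε = 1/4 ≤ ‖f‖₂√E = 1`).
-/

namespace Summit.AnomalousDissipation.AnomalousDissipation.Cruxes.QuarticGate.Disproof

open MeasureTheory Filter Topology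
open scoped ENNReal InnerProductSpace RealInnerProductSpace
open Literature.Analysis.FunctionSpaces Literature.Analysis.FluidPDE
open Summit.AnomalousDissipation.AnomalousDissipation.Theses.MomentParity

set_option linter.dupNamespace false

noncomputable section

/-! ## Vocabulary (verbatim clauses of `QuarticGate`, named) -/

/-- Level-`N` carried field: `û(k) = 0` off `0 < |k|² ≤ N²` (verbatim clause of `QuarticGate`). -/
def IsLevel (N : ℕ) (u : Torus.energySpace (Fin 3)) : Prop :=
  ∀ k ∉ (Torus.freqBall N).erase (0 : Fin 3 → ℤ),
    UnitAddTorus.mFourierCoeff (EuclideanSpace.complexify ∘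
      (u.1 : UnitAddTorus (Fin 3) → EuclideanSpace ℝ (Fin 3))) k = 0

/-- Band-limited smooth solenoidal mean-zero test field (verbatim clause of `QuarticGate`). -/
def IsBandTest (N : ℕ) (g : UnitAddTorus (Fin 3) → EuclideanSpace ℝ (Fin 3)) : Prop :=
  Torus.IsSmooth g ∧ Torus.IsDivFree g ∧ Torus.HasZeroMean g ∧
    ∀ k ∉ (Torus.freqBall N).erase (0 : Fin 3 → ℤ),
      UnitAddTorus.mFourierCoeff (EuclideanSpace.complexify ∘ g) k = 0

/-- `∇p(u) = Σᵢ ∂ᵢP((u,g₁),…,(u,gₘ)) gᵢ` (verbatim test-field expression of `QuarticGate`). -/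
def polyGrad {m : ℕ} (g : Fin m → UnitAddTorus (Fin 3) → EuclideanSpace ℝ (Fin 3))
    (P : MvPolynomial (Fin m) ℝ) (u : Torus.energySpace (Fin 3)) :
    UnitAddTorus (Fin 3) → EuclideanSpace ℝ (Fin 3) :=
  fun x => ∑ i : Fin m,
    (MvPolynomial.eval (fun j => Torus.pairing u.1 (g j)) (MvPolynomial.pderiv i P)) • g i x

/-- `d`-stationarity of `μ` for Galerkin NS at `(ν, f)` and level `N`: every polynomial cylindrical
observable of total degree `≤ d − 1` with level-`N` band tests is drift-free (row integrable and `0`). -/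
def IsPolyStationary (ν : ℝ) (f : UnitAddTorus (Fin 3) → EuclideanSpace ℝ (Fin 3)) (N d : ℕ)
    (μ : Measure (Torus.energySpace (Fin 3))) : Prop :=
  ∀ (m : ℕ) (g : Fin m → UnitAddTorus (Fin 3) → EuclideanSpace ℝ (Fin 3))
    (P : MvPolynomial (Fin m) ℝ), (∀ i, IsBandTest N (g i)) → P.totalDegree + 1 ≤ d →
    Integrable (fun u => Torus.nsGeneratorPairing ν f u (polyGrad g P u)) μ ∧
      ∫ u, Torus.nsGeneratorPairing ν f u (polyGrad g P u) ∂μ = 0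

/-- The level-`N` witness clauses of `QuarticGate` at viscosity `ν` with budgets `E`, `ε`. -/
def IsQuarticWitness (f : UnitAddTorus (Fin 3) → EuclideanSpace ℝ (Fin 3)) (ν : ℝ) (N : ℕ)
    (E ε : ℝ) (μ : Measure (Torus.energySpace (Fin 3))) : Prop :=
  IsProbabilityMeasure μ ∧ (∀ᵐ u ∂μ, IsLevel N u) ∧
    Integrable (fun u : Torus.energySpace (Fin 3) => ‖u‖ ^ 4) μ ∧
    IsPolyStationary ν f N 4 μ ∧ Torus.ensembleEnergy μ ≤ E ∧ ε ≤ Torus.ensembleDissipation ν μ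

/-- `QuarticGate` restated through the vocabulary (definitional unfolding, `Iff.rfl`). -/
theorem quarticGate_iff :
    QuarticGate ↔ ∃ f : UnitAddTorus (Fin 3) → EuclideanSpace ℝ (Fin 3),
      Torus.IsSmooth f ∧ Torus.IsDivFree f ∧ Torus.HasZeroMean f ∧
      ∃ (ν : ℕ → ℝ) (E ε : ℝ), (∀ j, 0 < ν j) ∧ Tendsto ν atTop (𝓝 0) ∧ 0 < ε ∧
      ∀ j : ℕ, ∃ᶠ N in atTop, ∃ μ, IsQuarticWitness f (ν j) N E ε μ :=
  Iff.rfl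


/-! ## A. The level-`N` dissipation ceiling (Bernstein) — loud witnesses need `N ≳ ν^{-1/2}` -/

section Ceiling

variable {d : Type*} [Fintype d] [DecidableEq d]

/-- **Bernstein inequality, spectral form.** An `L²` field carried by the frequencies
`0 < |k|² ≤ N²` has `‖∇v‖₂² ≤ 4π²N² ‖v‖₂²` (in `ℝ≥0∞`). [folklore] -/
theorem eGradNormSq_le_of_level {N : ℕ}
    (v : Lp (EuclideanSpace ℝ d) 2 (volume : Measure (UnitAddTorus d)))
    (hv : ∀ k ∉ (Torus.freqBall N).erase (0 : d → ℤ),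
      UnitAddTorus.mFourierCoeff (EuclideanSpace.complexify ∘
        (v : UnitAddTorus d → EuclideanSpace ℝ d)) k = 0) :
    Torus.eGradNormSq (v : UnitAddTorus d → EuclideanSpace ℝ d) ≤
      ENNReal.ofReal (4 * Real.pi ^ 2 * (N : ℝ) ^ 2) * ‖v‖ₑ ^ 2 := by
  rw [Torus.eGradNormSq_eq_tsum, Torus.enorm_sq_coe_eq_tsum, ← ENNReal.tsum_mul_left,
    ← ENNReal.tsum_mul_left]
  refine ENNReal.tsum_le_tsum fun k => ?_
  by_cases hk : k ∈ (Torus.freqBall N).erase (0 : d → ℤ)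
  · have hkN : Torus.freqNormSq k ≤ (N : ℝ) ^ 2 := Torus.mem_freqBall.1 (Finset.mem_of_mem_erase hk)
    rw [← mul_assoc, ← ENNReal.ofReal_mul (by positivity)]
    gcongr
  · rw [hv k hk]
    simp

/-- **Level ceiling for the mean enstrophy**: a measure carried by level-`N` fields has
`∫ ‖∇u‖² dμ ≤ 4π²N² ∫ |u|² dμ` (in `ℝ≥0∞`). [folklore] -/
theorem ensembleEnstrophy_le_of_level {N : ℕ} {μ : Measure (Torus.energySpace d)}
    (hlev : ∀ᵐ u : Torus.energySpace d ∂μ, ∀ k ∉ (Torus.freqBall N).erase (0 : d → ℤ),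
      UnitAddTorus.mFourierCoeff (EuclideanSpace.complexify ∘
        (u.1 : UnitAddTorus d → EuclideanSpace ℝ d)) k = 0) :
    Torus.ensembleEnstrophy μ ≤
      ENNReal.ofReal (4 * Real.pi ^ 2 * (N : ℝ) ^ 2) * ∫⁻ u, ‖u‖ₑ ^ 2 ∂μ := by
  rw [Torus.ensembleEnstrophy, ← lintegral_const_mul' _ _ ENNReal.ofReal_ne_top]
  exact lintegral_mono_ae (hlev.mono fun u hu => eGradNormSq_le_of_level _ hu)

/-- **Level ceiling for the dissipation**: a finite measure carried by level-`N` fields with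
finite mean energy has `ν ∫‖∇u‖² dμ ≤ 4π²N² ν ∫|u|² dμ`, i.e.
`ensembleDissipation ν μ ≤ 4π² N² ν · ensembleEnergy μ` (`0 ≤ ν`). Bounded level-`N` ensembles are
quiet as `ν → 0`: the `∃ᶠ N` of `QuarticGate` must escape to infinity at least like
`N ≥ (ε / (4π² ν_j E))^{1/2}` (cf. the route header's NUMBERS line). [folklore] -/
theorem ensembleDissipation_le_of_level {ν : ℝ} (hν : 0 ≤ ν) {N : ℕ}
    {μ : Measure (Torus.energySpace d)}
    (hlev : ∀ᵐ u : Torus.energySpace d ∂μ, ∀ k ∉ (Torus.freqBall N).erase (0 : d → ℤ),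
      UnitAddTorus.mFourierCoeff (EuclideanSpace.complexify ∘
        (u.1 : UnitAddTorus d → EuclideanSpace ℝ d)) k = 0)
    (hE : Integrable (fun u : Torus.energySpace d => ‖u‖ ^ 2) μ) :
    Torus.ensembleDissipation ν μ ≤ 4 * Real.pi ^ 2 * (N : ℝ) ^ 2 * ν * Torus.ensembleEnergy μ := by
  have h1 := ensembleEnstrophy_le_of_level hlev
  have h2 : ∫⁻ u, ‖u‖ₑ ^ 2 ∂μ = ENNReal.ofReal (Torus.ensembleEnergy μ) := by
    rw [Torus.ensembleEnergy, ofReal_integral_eq_lintegral_ofReal hE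
      (ae_of_all _ fun u => by positivity)]
    refine lintegral_congr fun u => ?_
    rw [← ofReal_norm, ← ENNReal.ofReal_pow (norm_nonneg _)]
  rw [h2, ← ENNReal.ofReal_mul (by positivity)] at h1
  have hE0 : 0 ≤ Torus.ensembleEnergy μ := integral_nonneg fun u => by positivity
  have h3 : (Torus.ensembleEnstrophy μ).toReal ≤ 4 * Real.pi ^ 2 * (N : ℝ) ^ 2 * Torus.ensembleEnergy μ := by
    have := ENNReal.toReal_mono ENNReal.ofReal_ne_top h1
    rwa [ENNReal.toReal_ofReal (by positivity)] at this
  unfold Torus.ensembleDissipation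
  calc ν * (Torus.ensembleEnstrophy μ).toReal
      ≤ ν * (4 * Real.pi ^ 2 * (N : ℝ) ^ 2 * Torus.ensembleEnergy μ) :=
        mul_le_mul_of_nonneg_left h3 hν
    _ = 4 * Real.pi ^ 2 * (N : ℝ) ^ 2 * ν * Torus.ensembleEnergy μ := by ring

end Ceiling

/-- On a finite measure, `‖u‖⁴` integrable ⇒ `‖u‖²` integrable. [folklore] -/
theorem integrable_norm_sq_of_norm_pow_four {μ : Measure (Torus.energySpace (Fin 3))}
    [IsFiniteMeasure μ] (h4 : Integrable (fun u : Torus.energySpace (Fin 3) => ‖u‖ ^ 4) μ) :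
    Integrable (fun u : Torus.energySpace (Fin 3) => ‖u‖ ^ 2) μ := by
  refine Integrable.mono' ((integrable_const (1 : ℝ)).add h4)
    (continuous_norm.pow 2).aestronglyMeasurable (ae_of_all _ fun u => ?_)
  simp only [Pi.add_apply, Real.norm_eq_abs, abs_of_nonneg (by positivity : (0 : ℝ) ≤ ‖u‖ ^ 2)]
  nlinarith [sq_nonneg (‖u‖ ^ 2 - 1), sq_nonneg ‖u‖]

/-- **Quantitative ceiling for witnesses**: a level-`N` witness of `QuarticGate` at viscosity
`ν ≥ 0` obeys `ε ≤ 4π² N² ν E` (only the level clause, the fourth-moment clause and the two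
budget clauses are used — stationarity is NOT used). [folklore] -/
theorem IsQuarticWitness.eps_le {f : UnitAddTorus (Fin 3) → EuclideanSpace ℝ (Fin 3)} {ν : ℝ}
    (hν : 0 ≤ ν) {N : ℕ} {E ε : ℝ} {μ : Measure (Torus.energySpace (Fin 3))}
    (h : IsQuarticWitness f ν N E ε μ) : ε ≤ 4 * Real.pi ^ 2 * (N : ℝ) ^ 2 * ν * E := by
  obtain ⟨hprob, hlev, h4, -, hEn, hε⟩ := h
  have hdiss := ensembleDissipation_le_of_level hν hlev (integrable_norm_sq_of_norm_pow_four h4)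
  have hE0 : 0 ≤ Torus.ensembleEnergy μ := integral_nonneg fun u => by positivity
  calc ε ≤ Torus.ensembleDissipation ν μ := hε
    _ ≤ 4 * Real.pi ^ 2 * (N : ℝ) ^ 2 * ν * Torus.ensembleEnergy μ := hdiss
    _ ≤ 4 * Real.pi ^ 2 * (N : ℝ) ^ 2 * ν * E := by gcongr

/-- At a FIXED level `N`, witnesses exist for only finitely many `j` along any `ν_j → 0`. -/
theorem eventually_not_isQuarticWitness (f : UnitAddTorus (Fin 3) → EuclideanSpace ℝ (Fin 3))
    {ν : ℕ → ℝ} (hν : ∀ j, 0 < ν j) (hν0 : Tendsto ν atTop (𝓝 0)) (E : ℝ) {ε : ℝ} (hε : 0 < ε)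
    (N : ℕ) : ∀ᶠ j in atTop, ∀ μ, ¬ IsQuarticWitness f (ν j) N E ε μ := by
  set C : ℝ := 4 * Real.pi ^ 2 * (N : ℝ) ^ 2 * max E 0 + 1 with hC
  have hCpos : 0 < C := by positivity
  have hev : ∀ᶠ j in atTop, ν j < ε / C :=
    (tendsto_order.1 hν0).2 _ (div_pos hε hCpos)
  refine hev.mono fun j hj μ hw => ?_
  have h1 := hw.eps_le (hν j).le
  have h2 : 4 * Real.pi ^ 2 * (N : ℝ) ^ 2 * ν j * E ≤ ν j * (C - 1) := by
    have : 4 * Real.pi ^ 2 * (N : ℝ) ^ 2 * ν j * E ≤ 4 * Real.pi ^ 2 * (N : ℝ) ^ 2 * ν j * max E 0 := by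
      gcongr
      · exact mul_nonneg (by positivity) (hν j).le
      · exact le_max_left _ _
    rw [hC]; nlinarith [this]
  have h3 : ν j * (C - 1) < ε := by
    have := (lt_div_iff₀ hCpos).1 hj
    nlinarith [(hν j).le]
  linarith

/-- NATURAL STRENGTHENING 1 (refuted): `QuarticGate` with the Galerkin level `N` chosen BEFORE the
viscosity index `j` (even only frequently in `j`). -/
def QuarticGateBoundedLevel : Prop :=
  ∃ f : UnitAddTorus (Fin 3) → EuclideanSpace ℝ (Fin 3),
    Torus.IsSmooth f ∧ Torus.IsDivFree f ∧ Torus.HasZeroMean f ∧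
    ∃ (ν : ℕ → ℝ) (E ε : ℝ), (∀ j, 0 < ν j) ∧ Tendsto ν atTop (𝓝 0) ∧ 0 < ε ∧
    ∃ N : ℕ, ∃ᶠ j in atTop, ∃ μ, IsQuarticWitness f (ν j) N E ε μ

/-- **`¬ QuarticGateBoundedLevel`**: no level can be uniform in `j` — the dissipation of a level-`N`
ensemble of energy `≤ E` is `≤ 4π²N²ν_jE → 0`. So every proof of `QuarticGate` must let its levels
`N` escape to infinity (at least like `ν_j^{-1/2}`); every construction at `N ≍ ν_j^{-1/2}` serves
finitely many `j` per level (this is the Taylor-window confinement that killed line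
`gibbs-sea-pushforward`, in its crudest form). [folklore] -/
theorem not_quarticGateBoundedLevel : ¬ QuarticGateBoundedLevel := by
  rintro ⟨f, -, -, -, ν, E, ε, hν, hν0, hε, N, hfreq⟩
  obtain ⟨j, ⟨μ, hμ⟩, hno⟩ :=
    (hfreq.and_eventually (eventually_not_isQuarticWitness f hν hν0 E hε N)).exists
  exact hno μ hμ


/-! ## B. Load-bearing clauses: weakenings of `QuarticGate` that hold trivially -/

section LoadBearing

/-- Fourier coefficients of the representative of `0 ∈ L²` vanish. [folklore] -/
theorem mFourierCoeff_coe_zero (k : Fin 3 → ℤ) :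
    UnitAddTorus.mFourierCoeff (EuclideanSpace.complexify ∘
      (((0 : Torus.energySpace (Fin 3)).1 :
        Lp (EuclideanSpace ℝ (Fin 3)) 2 (volume : Measure (UnitAddTorus (Fin 3)))) :
          UnitAddTorus (Fin 3) → EuclideanSpace ℝ (Fin 3))) k = 0 := by
  rw [Torus.mFourierCoeff_eq_integral_volume]
  have h0 := Lp.coeFn_zero (EuclideanSpace ℝ (Fin 3)) 2 (volume : Measure (UnitAddTorus (Fin 3)))
  rw [integral_congr_ae (g := fun _ => (0 : EuclideanSpace ℂ (Fin 3))) (h0.mono fun x hx => by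
    simp only [Submodule.coe_zero, Function.comp_apply]
    rw [hx]; simp)]
  simp

/-- The generator row vanishes at `u = 0` when `f = 0`: `⟨F(0), w⟩ = 0`. [folklore] -/
theorem nsGeneratorPairing_zero_zero (ν : ℝ) (w : UnitAddTorus (Fin 3) → EuclideanSpace ℝ (Fin 3)) :
    Torus.nsGeneratorPairing ν (fun _ => 0) (0 : Torus.energySpace (Fin 3)) w = 0 := by
  unfold Torus.nsGeneratorPairing Torus.inertialPairing
  simp

/-- The Dirac mass at `0 ∈ H` is a (trivially loud-free) witness at every level for `f = 0`,
`E = 0`, `ε = 0`: all rows vanish identically. [folklore] -/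
theorem isQuarticWitness_dirac_zero (ν : ℝ) (hν : 0 ≤ ν) (N : ℕ) :
    IsQuarticWitness (fun _ => 0) ν N 0 0 (Measure.dirac (0 : Torus.energySpace (Fin 3))) := by
  haveI : MeasurableSingletonClass (Torus.energySpace (Fin 3)) :=
    OpensMeasurableSpace.toMeasurableSingletonClass
  refine ⟨inferInstance, ?_, Torus.integrable_dirac _ _, ?_, ?_, ?_⟩
  · rw [ae_dirac_eq]
    simp only [eventually_pure]
    intro k _
    exact mFourierCoeff_coe_zero k
  · intro m g P _ _
    refine ⟨Torus.integrable_dirac _ _, ?_⟩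
    rw [integral_dirac]
    exact nsGeneratorPairing_zero_zero ν _
  · simp [Torus.ensembleEnergy, integral_dirac]
  · exact mul_nonneg hν ENNReal.toReal_nonneg

/-- WEAKENING 1 (holds trivially): `QuarticGate` without `0 < ε`. -/
def QuarticGateWithoutEpsPos : Prop :=
  ∃ f : UnitAddTorus (Fin 3) → EuclideanSpace ℝ (Fin 3),
    Torus.IsSmooth f ∧ Torus.IsDivFree f ∧ Torus.HasZeroMean f ∧
    ∃ (ν : ℕ → ℝ) (E ε : ℝ), (∀ j, 0 < ν j) ∧ Tendsto ν atTop (𝓝 0) ∧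
    ∀ j : ℕ, ∃ᶠ N in atTop, ∃ μ, IsQuarticWitness f (ν j) N E ε μ

/-- **`0 < ε` is load-bearing**: without it `δ₀` with `f = 0` witnesses everything
(`ν_j = 1/(j+1)`, `E = ε = 0`). Any proof of `QuarticGate` lives entirely in the loudness floor. -/
theorem quarticGateWithoutEpsPos_holds : QuarticGateWithoutEpsPos := by
  have hzero : (Torus.realTrigPoly (∅ : Finset (Fin 3 → ℤ)) (0 : (Fin 3 → ℤ) → EuclideanSpace ℂ (Fin 3)))
      = fun _ => 0 := Torus.realTrigPoly_zero ∅
  refine ⟨fun _ => 0, Torus.isSmooth_const _, ?_, ?_, fun j => 1 / ((j : ℝ) + 1), 0, 0,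
    fun j => by positivity, tendsto_one_div_add_atTop_nhds_zero_nat, fun j => ?_⟩
  · rw [← hzero]
    exact Torus.isDivFree_realTrigPoly fun k hk => by simp at hk
  · simp [Torus.HasZeroMean]
  · exact Frequently.of_forall fun N => ⟨_, isQuarticWitness_dirac_zero _ (by positivity) N⟩

end LoadBearing


/-! ## C. The energy row of a polynomially stationary level-`N` law, and the force floor -/

section EnergyRow

/-- Local notation for the real Hilbert space `L²(T³; ℝ³)`. -/
local notation "L2T3" => Lp (EuclideanSpace ℝ (Fin 3)) 2 (volume : Measure (UnitAddTorus (Fin 3)))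

/-- The level-`N` frame fields `g_{kjc}` (`0 < |k|² ≤ N²`, `j : Fin 3`, `c : Bool`), `Fin`-indexed. -/
def frameG (N : ℕ) (i : Fin (Fintype.card (Torus.FrameIdx (Fin 3) N))) :
    UnitAddTorus (Fin 3) → EuclideanSpace ℝ (Fin 3) :=
  Torus.frameFieldIdx N ((Fintype.equivFin (Torus.FrameIdx (Fin 3) N)).symm i)

/-- The quadratic energy observable `P = Σᵢ Xᵢ²` on `n` coordinates. -/
def energyPoly (n : ℕ) : MvPolynomial (Fin n) ℝ := ∑ j : Fin n, (MvPolynomial.X j) ^ 2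

/-- `Σᵢ Xᵢ²` has total degree `≤ 2`. [folklore] -/
theorem totalDegree_energyPoly (n : ℕ) : (energyPoly n).totalDegree ≤ 2 := by
  refine (MvPolynomial.totalDegree_finsetSum _ _).trans (Finset.sup_le fun j _ => ?_)
  rw [MvPolynomial.totalDegree_X_pow]

/-- `∂ᵢ(Σⱼ Xⱼ²)` evaluates to `2xᵢ`. [folklore] -/
theorem eval_pderiv_energyPoly {n : ℕ} (x : Fin n → ℝ) (i : Fin n) :
    MvPolynomial.eval x (MvPolynomial.pderiv i (energyPoly n)) = 2 * x i := by
  simp [energyPoly, map_sum, Derivation.leibniz_pow, MvPolynomial.pderiv_X, Pi.single_apply,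
    Finset.sum_ite_eq', smul_eq_mul]

/-- Frame fields are admissible band tests at their own level. [folklore] -/
theorem isBandTest_frameG (N : ℕ) (i : Fin (Fintype.card (Torus.FrameIdx (Fin 3) N))) :
    IsBandTest N (frameG N i) := by
  set p := (Fintype.equivFin (Torus.FrameIdx (Fin 3) N)).symm i with hp
  have hk0 : (p.1 : Fin 3 → ℤ) ≠ 0 := Torus.ne_zero_of_mem_freqBall₀ _
  have hkN : (p.1 : Fin 3 → ℤ) ∈ Torus.freqBall N := Finset.mem_of_mem_erase p.1.2
  refine ⟨Torus.isSmooth_realTrigPoly _ _, Torus.isDivFree_frameField hk0 _ _,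
    Torus.integral_frameField hk0 _ _, fun k' hk' => ?_⟩
  change UnitAddTorus.mFourierCoeff (EuclideanSpace.complexify ∘
    Torus.realTrigPoly {(p.1 : Fin 3 → ℤ)} (fun _ => Torus.frameVec (p.1 : Fin 3 → ℤ) p.2.1 p.2.2)) k' = 0
  by_cases h0 : k' = 0
  · subst h0
    refine Torus.mFourierCoeff_realTrigPoly_eq_zero_of_not_mem _ ?_ ?_ <;>
      simpa [Finset.mem_singleton] using fun h => hk0 h.symm
  · have hk'N : k' ∉ Torus.freqBall N := fun h => hk' (Finset.mem_erase.2 ⟨h0, h⟩)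
    exact Torus.mFourierCoeff_realTrigPoly_singleton_eq_zero _ _
      ((Torus.mem_freqBall.1 hkN).trans_lt (Torus.not_mem_freqBall.1 hk'N))

/-- **The differential of the energy observable is twice the truncation**:
`∇(Σ (u,g_{kjc})²) = 2 P_N u` (Parseval frame identity `sum_integral_inner_frameField_smul`). -/
theorem polyGrad_energyPoly (N : ℕ) (u : Torus.energySpace (Fin 3)) :
    polyGrad (frameG N) (energyPoly _) u =
      fun x => (2 : ℝ) • Torus.fourierTruncate N ((u.1 : L2T3) : UnitAddTorus (Fin 3) → EuclideanSpace ℝ (Fin 3)) x := by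
  funext x
  simp only [polyGrad, eval_pderiv_energyPoly, mul_smul, ← Finset.smul_sum]
  congr 1
  have h1 : ∑ i : Fin (Fintype.card (Torus.FrameIdx (Fin 3) N)),
      Torus.pairing u.1 (frameG N i) • frameG N i x =
      ∑ q : Torus.FrameIdx (Fin 3) N, Torus.pairing u.1 (Torus.frameFieldIdx N q) • Torus.frameFieldIdx N q x :=
    Fintype.sum_equiv (Fintype.equivFin (Torus.FrameIdx (Fin 3) N)).symm _ _ fun _ => rfl
  rw [h1, Fintype.sum_prod_type, ← Torus.sum_integral_inner_frameField_smul u.2 N x,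
    ← Finset.sum_coe_sort (Torus.freqBall₀ N)]
  refine Finset.sum_congr rfl fun k _ => ?_
  rw [Fintype.sum_prod_type]
  rfl

/-- A field of `L²` carried by the ball of radius `N` equals its truncation a.e. on the torus. [folklore] -/
theorem fourierTruncate_ae_eq_of_level {N : ℕ} (v : L2T3)
    (hv : ∀ k ∉ (Torus.freqBall N).erase (0 : Fin 3 → ℤ),
      UnitAddTorus.mFourierCoeff (EuclideanSpace.complexify ∘
        (v : UnitAddTorus (Fin 3) → EuclideanSpace ℝ (Fin 3))) k = 0) :
    (fun x => Torus.fourierTruncate N (v : UnitAddTorus (Fin 3) → EuclideanSpace ℝ (Fin 3)) x) =ᵐ[volume]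
      (v : UnitAddTorus (Fin 3) → EuclideanSpace ℝ (Fin 3)) := by
  have hmem : MemLp (v : UnitAddTorus (Fin 3) → EuclideanSpace ℝ (Fin 3)) 2 volume := Lp.memLp v
  have h := Torus.lintegral_enorm_sq_fourierTruncate_sub hmem N
  have h0 : (∑' k : {k : Fin 3 → ℤ // k ∉ Torus.freqBall N},
      ‖UnitAddTorus.mFourierCoeff (EuclideanSpace.complexify ∘
        (v : UnitAddTorus (Fin 3) → EuclideanSpace ℝ (Fin 3))) k‖ₑ ^ 2) = 0 := by
    refine ENNReal.tsum_eq_zero.2 fun k => ?_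
    rw [hv k fun hk => k.2 (Finset.mem_of_mem_erase hk)]
    simp
  rw [h0] at h
  have hmeas : AEMeasurable (fun x => ‖Torus.fourierTruncate N
      (v : UnitAddTorus (Fin 3) → EuclideanSpace ℝ (Fin 3)) x -
        (v : UnitAddTorus (Fin 3) → EuclideanSpace ℝ (Fin 3)) x‖ₑ ^ 2) volume :=
    ((Torus.continuous_fourierTruncate N _).aestronglyMeasurable.sub
      hmem.aestronglyMeasurable).enorm.pow_const 2
  filter_upwards [(lintegral_eq_zero_iff' hmeas).1 h] with x hx
  have hx' : ‖Torus.fourierTruncate N (v : UnitAddTorus (Fin 3) → EuclideanSpace ℝ (Fin 3)) x -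
      (v : UnitAddTorus (Fin 3) → EuclideanSpace ℝ (Fin 3)) x‖ₑ = 0 := by
    simpa using hx
  exact sub_eq_zero.1 (enorm_eq_zero.1 hx')

/-- The spectral enstrophy of a level-`N` field is that of its truncation. [folklore] -/
theorem eGradNormSq_fourierTruncate_of_level {N : ℕ} (v : L2T3)
    (hv : ∀ k ∉ (Torus.freqBall N).erase (0 : Fin 3 → ℤ),
      UnitAddTorus.mFourierCoeff (EuclideanSpace.complexify ∘
        (v : UnitAddTorus (Fin 3) → EuclideanSpace ℝ (Fin 3))) k = 0) :
    Torus.eGradNormSq (Torus.fourierTruncate N (v : UnitAddTorus (Fin 3) → EuclideanSpace ℝ (Fin 3))) =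
      Torus.eGradNormSq (v : UnitAddTorus (Fin 3) → EuclideanSpace ℝ (Fin 3)) := by
  have hint : Integrable (v : UnitAddTorus (Fin 3) → EuclideanSpace ℝ (Fin 3)) volume :=
    (Lp.memLp v).integrable one_le_two
  rw [Torus.eGradNormSq_eq_tsum, Torus.eGradNormSq_eq_tsum]
  congr 1
  refine tsum_congr fun k => ?_
  rw [Torus.mFourierCoeff_fourierTruncate hint]
  split_ifs with hk
  · rfl
  · rw [hv k fun h => hk (Finset.mem_of_mem_erase h)]

/-- On a level-`N` field the inertial term against its own truncation vanishes:
`∫ (u ⊗ u) : ∇(P_N u) = ½ ∫ u · ∇|u|² = 0`. [folklore] -/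
theorem inertialPairing_fourierTruncate_of_level {N : ℕ} (u : Torus.energySpace (Fin 3))
    (hu : IsLevel N u) :
    Torus.inertialPairing (u.1 : L2T3)
      (Torus.fourierTruncate N ((u.1 : L2T3) : UnitAddTorus (Fin 3) → EuclideanSpace ℝ (Fin 3))) = 0 := by
  rw [Torus.inertialPairing_fourierTruncate_eq u.2 N]
  refine (integral_congr_ae (g := fun _ => (0 : ℝ)) ?_).trans (by simp)
  filter_upwards [fourierTruncate_ae_eq_of_level (u.1 : L2T3) hu] with x hx
  rw [hx, sub_self, inner_zero_right]

/-- On a level-`N` field, `(f, P_N u) = (u, f)`. [folklore] -/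
theorem integral_inner_fourierTruncate_of_level {N : ℕ} (v : L2T3)
    (hv : ∀ k ∉ (Torus.freqBall N).erase (0 : Fin 3 → ℤ),
      UnitAddTorus.mFourierCoeff (EuclideanSpace.complexify ∘
        (v : UnitAddTorus (Fin 3) → EuclideanSpace ℝ (Fin 3))) k = 0)
    (f : UnitAddTorus (Fin 3) → EuclideanSpace ℝ (Fin 3)) :
    ∫ x, ⟪f x, Torus.fourierTruncate N (v : UnitAddTorus (Fin 3) → EuclideanSpace ℝ (Fin 3)) x⟫_ℝ =
      Torus.pairing v f := by
  unfold Torus.pairing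
  refine integral_congr_ae ?_
  filter_upwards [fourierTruncate_ae_eq_of_level v hv] with x hx
  rw [hx, real_inner_comm]

/-- **The energy row, pointwise**: at a level-`N` field the row of the energy observable is
`⟨F(u), 2P_N u⟩ = 2((f,u) − ν‖∇u‖²)`. [folklore] -/
theorem row_energyPoly_of_level (ν : ℝ) (f : UnitAddTorus (Fin 3) → EuclideanSpace ℝ (Fin 3))
    {N : ℕ} (u : Torus.energySpace (Fin 3)) (hu : IsLevel N u) :
    Torus.nsGeneratorPairing ν f u (polyGrad (frameG N) (energyPoly _) u) =
      2 * (Torus.pairing u.1 f -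
        ν * (Torus.eGradNormSq ((u.1 : L2T3) : UnitAddTorus (Fin 3) → EuclideanSpace ℝ (Fin 3))).toReal) := by
  rw [polyGrad_energyPoly, Torus.nsGeneratorPairing_smul_fourierTruncate ν f u 2 N,
    inertialPairing_fourierTruncate_of_level u hu, eGradNormSq_fourierTruncate_of_level _ hu,
    integral_inner_fourierTruncate_of_level _ hu f]
  ring

/-- Pointwise level ceiling in real form: `‖∇u‖² ≤ 4π²N²‖u‖²` on level-`N` fields. [folklore] -/
theorem toReal_eGradNormSq_le_of_level {N : ℕ} (u : Torus.energySpace (Fin 3)) (hu : IsLevel N u) :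
    (Torus.eGradNormSq ((u.1 : L2T3) : UnitAddTorus (Fin 3) → EuclideanSpace ℝ (Fin 3))).toReal ≤
      4 * Real.pi ^ 2 * (N : ℝ) ^ 2 * ‖u‖ ^ 2 := by
  have h := eGradNormSq_le_of_level (u.1 : L2T3) hu
  have h' : ENNReal.ofReal (4 * Real.pi ^ 2 * (N : ℝ) ^ 2) * ‖(u.1 : L2T3)‖ₑ ^ 2 =
      ENNReal.ofReal (4 * Real.pi ^ 2 * (N : ℝ) ^ 2 * ‖u‖ ^ 2) := by
    rw [← ofReal_norm, ← ENNReal.ofReal_pow (norm_nonneg _), ← ENNReal.ofReal_mul (by positivity),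
      Submodule.coe_norm]
  rw [h'] at h
  have := ENNReal.toReal_mono ENNReal.ofReal_ne_top h
  rwa [ENNReal.toReal_ofReal (by positivity)] at this

/-- **THE ENERGY ROW** of a polynomially `d`-stationary (`d ≥ 3`) level-`N` law with finite mean
energy: `ν ∫ ‖∇u‖² dμ = ∫ (f, u) dμ` — the quadratic test `Σ_{kjc} (u, g_{kjc})²` over the level-`N`
frame is admissible (`totalDegree 2`), its differential is `2P_N u = 2u` on the support, and
`b(u,u,u) = 0`. (FMRT's energy EQUATION, here exact because the law is finite-dimensional.) [folklore] -/
theorem energy_row_of_polyStationary {ν : ℝ} (f : UnitAddTorus (Fin 3) → EuclideanSpace ℝ (Fin 3))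
    (hf : MemLp f 2 volume) {N : ℕ} {μ : Measure (Torus.energySpace (Fin 3))} [IsFiniteMeasure μ]
    (hlev : ∀ᵐ u ∂μ, IsLevel N u)
    (h2 : Integrable (fun u : Torus.energySpace (Fin 3) => ‖u‖ ^ 2) μ) {d : ℕ} (hd : 3 ≤ d)
    (hstat : IsPolyStationary ν f N d μ) :
    ν * ∫ u, (Torus.eGradNormSq ((u.1 : L2T3) : UnitAddTorus (Fin 3) → EuclideanSpace ℝ (Fin 3))).toReal ∂μ =
      ∫ u, Torus.pairing u.1 f ∂μ := by
  obtain ⟨-, hzero⟩ := hstat _ (frameG N) (energyPoly _) (isBandTest_frameG N)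
    (by have := totalDegree_energyPoly (Fintype.card (Torus.FrameIdx (Fin 3) N)); omega)
  have hrow : (fun u => Torus.nsGeneratorPairing ν f u (polyGrad (frameG N) (energyPoly _) u)) =ᵐ[μ]
      fun u => 2 * (Torus.pairing u.1 f -
        ν * (Torus.eGradNormSq ((u.1 : L2T3) : UnitAddTorus (Fin 3) → EuclideanSpace ℝ (Fin 3))).toReal) :=
    hlev.mono fun u hu => row_energyPoly_of_level ν f u hu
  -- integrability of the two pieces
  have hnorm : Integrable (fun u : Torus.energySpace (Fin 3) => ‖u‖) μ :=
    ((memLp_two_iff_integrable_sq continuous_norm.aestronglyMeasurable).2 h2).integrable one_le_two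
  have hpair : Integrable (fun u : Torus.energySpace (Fin 3) => Torus.pairing u.1 f) μ := by
    refine Integrable.mono' (hnorm.mul_const ‖hf.toLp f‖)
      (Torus.continuous_pairing_coe hf).aestronglyMeasurable (ae_of_all _ fun u => ?_)
    rw [Real.norm_eq_abs]
    exact Torus.abs_pairing_coe_le hf u
  have hgrad : Integrable (fun u : Torus.energySpace (Fin 3) =>
      (Torus.eGradNormSq ((u.1 : L2T3) : UnitAddTorus (Fin 3) → EuclideanSpace ℝ (Fin 3))).toReal) μ := by
    refine Integrable.mono' (h2.const_mul (4 * Real.pi ^ 2 * (N : ℝ) ^ 2))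
      Torus.measurable_eGradNormSq_coe.ennreal_toReal.aestronglyMeasurable
      (hlev.mono fun u hu => ?_)
    rw [Real.norm_eq_abs, abs_of_nonneg ENNReal.toReal_nonneg]
    exact toReal_eGradNormSq_le_of_level u hu
  rw [integral_congr_ae hrow, integral_const_mul, integral_sub hpair (hgrad.const_mul ν),
    integral_const_mul] at hzero
  linarith

/-- **Dissipation = mean injection** for a polynomially `d`-stationary (`d ≥ 3`) level-`N` law:
`ensembleDissipation ν μ = ∫ (f, u) dμ`. [folklore] -/
theorem ensembleDissipation_eq_of_polyStationary {ν : ℝ}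
    (f : UnitAddTorus (Fin 3) → EuclideanSpace ℝ (Fin 3))
    (hf : MemLp f 2 volume) {N : ℕ} {μ : Measure (Torus.energySpace (Fin 3))} [IsFiniteMeasure μ]
    (hlev : ∀ᵐ u ∂μ, IsLevel N u)
    (h2 : Integrable (fun u : Torus.energySpace (Fin 3) => ‖u‖ ^ 2) μ) {d : ℕ} (hd : 3 ≤ d)
    (hstat : IsPolyStationary ν f N d μ) :
    Torus.ensembleDissipation ν μ = ∫ u, Torus.pairing u.1 f ∂μ := by
  have hfin : ∀ᵐ u : Torus.energySpace (Fin 3) ∂μ,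
      Torus.eGradNormSq ((u.1 : L2T3) : UnitAddTorus (Fin 3) → EuclideanSpace ℝ (Fin 3)) < ⊤ :=
    hlev.mono fun u hu => (eGradNormSq_le_of_level (u.1 : L2T3) hu).trans_lt
      (ENNReal.mul_lt_top ENNReal.ofReal_lt_top (ENNReal.pow_lt_top enorm_lt_top))
  unfold Torus.ensembleDissipation Torus.ensembleEnstrophy
  rw [← integral_toReal Torus.measurable_eGradNormSq_coe.aemeasurable hfin]
  exact energy_row_of_polyStationary f hf hlev h2 hd hstat

/-- **FORCE FLOOR**: a polynomially `d`-stationary (`d ≥ 3`) level-`N` probability law with finite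
mean energy has `ensembleDissipation ν μ ≤ ‖f‖_{L²} · (ensembleEnergy μ)^{1/2}`. [folklore] -/
theorem ensembleDissipation_le_of_polyStationary {ν : ℝ}
    (f : UnitAddTorus (Fin 3) → EuclideanSpace ℝ (Fin 3))
    (hf : MemLp f 2 volume) {N : ℕ} {μ : Measure (Torus.energySpace (Fin 3))} [IsProbabilityMeasure μ]
    (hlev : ∀ᵐ u ∂μ, IsLevel N u)
    (h2 : Integrable (fun u : Torus.energySpace (Fin 3) => ‖u‖ ^ 2) μ) {d : ℕ} (hd : 3 ≤ d)
    (hstat : IsPolyStationary ν f N d μ) :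
    Torus.ensembleDissipation ν μ ≤ Real.sqrt (∫ x, ‖f x‖ ^ 2) * Real.sqrt (Torus.ensembleEnergy μ) := by
  rw [ensembleDissipation_eq_of_polyStationary f hf hlev h2 hd hstat]
  have hnorm : Integrable (fun u : Torus.energySpace (Fin 3) => ‖u‖) μ :=
    ((memLp_two_iff_integrable_sq continuous_norm.aestronglyMeasurable).2 h2).integrable one_le_two
  have hCS : ∫ u : Torus.energySpace (Fin 3), ‖u‖ ∂μ ≤ Real.sqrt (Torus.ensembleEnergy μ) :=
    Torus.integral_le_sqrt_integral_sq (ae_of_all _ fun u => norm_nonneg u)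
      continuous_norm.aestronglyMeasurable h2
  calc ∫ u, Torus.pairing u.1 f ∂μ ≤ ‖∫ u, Torus.pairing u.1 f ∂μ‖ := Real.le_norm_self _
    _ ≤ ∫ u : Torus.energySpace (Fin 3), ‖hf.toLp f‖ * ‖u‖ ∂μ :=
        norm_integral_le_of_norm_le (hnorm.const_mul _) (ae_of_all _ fun u => by
          rw [Real.norm_eq_abs, mul_comm]
          exact Torus.abs_pairing_coe_le hf u)
    _ = ‖hf.toLp f‖ * ∫ u : Torus.energySpace (Fin 3), ‖u‖ ∂μ := integral_const_mul _ _
    _ ≤ ‖hf.toLp f‖ * Real.sqrt (Torus.ensembleEnergy μ) :=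
        mul_le_mul_of_nonneg_left hCS (norm_nonneg _)
    _ = Real.sqrt (∫ x, ‖f x‖ ^ 2) * Real.sqrt (Torus.ensembleEnergy μ) := by
        rw [Torus.norm_toLp_eq_sqrt hf]

/-- **Force floor for witnesses**: `ε ≤ ‖f‖_{L²} √E` for every level-`N` witness of `QuarticGate`
with an `L²` force (stationarity is used ONLY through the one quadratic energy test). [folklore] -/
theorem IsQuarticWitness.eps_le_force {f : UnitAddTorus (Fin 3) → EuclideanSpace ℝ (Fin 3)}
    (hf : MemLp f 2 volume) {ν : ℝ} {N : ℕ} {E ε : ℝ} {μ : Measure (Torus.energySpace (Fin 3))}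
    (h : IsQuarticWitness f ν N E ε μ) : ε ≤ Real.sqrt (∫ x, ‖f x‖ ^ 2) * Real.sqrt E := by
  obtain ⟨hprob, hlev, h4, hstat, hEn, hε⟩ := h
  have h2 := integrable_norm_sq_of_norm_pow_four h4
  calc ε ≤ Torus.ensembleDissipation ν μ := hε
    _ ≤ Real.sqrt (∫ x, ‖f x‖ ^ 2) * Real.sqrt (Torus.ensembleEnergy μ) :=
        ensembleDissipation_le_of_polyStationary f hf hlev h2 (le_refl 3)
          (fun m g P hg hP => hstat m g P hg (hP.trans (by norm_num)))
    _ ≤ Real.sqrt (∫ x, ‖f x‖ ^ 2) * Real.sqrt E := by gcongr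

/-- NATURAL STRENGTHENING 2 (refuted): `QuarticGate` for EVERY admissible force (the quantifier
pattern of `CubicParityLoud`, without its `f ≠ 0`). -/
def QuarticGateEveryForce : Prop :=
  ∀ f : UnitAddTorus (Fin 3) → EuclideanSpace ℝ (Fin 3),
    Torus.IsSmooth f → Torus.IsDivFree f → Torus.HasZeroMean f →
    ∃ (ν : ℕ → ℝ) (E ε : ℝ), (∀ j, 0 < ν j) ∧ Tendsto ν atTop (𝓝 0) ∧ 0 < ε ∧
    ∀ j : ℕ, ∃ᶠ N in atTop, ∃ μ, IsQuarticWitness f (ν j) N E ε μ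

/-- **`¬ QuarticGateEveryForce`**: the zero force is quiet at every order (`ε ≤ ‖0‖ √E = 0`). The
`∃ f` of the crux is load-bearing and the witness force must satisfy `‖f‖_{L²} ≥ ε/√E`. [folklore] -/
theorem not_quarticGateEveryForce : ¬ QuarticGateEveryForce := by
  intro h
  have hzero : (Torus.realTrigPoly (∅ : Finset (Fin 3 → ℤ)) (0 : (Fin 3 → ℤ) → EuclideanSpace ℂ (Fin 3)))
      = fun _ => 0 := Torus.realTrigPoly_zero ∅
  obtain ⟨ν, E, ε, hν, -, hε, hj⟩ := h (fun _ => 0) (Torus.isSmooth_const _)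
    (by rw [← hzero]; exact Torus.isDivFree_realTrigPoly fun k hk => by simp at hk)
    (by simp [Torus.HasZeroMean])
  obtain ⟨N, μ, hμ⟩ := (hj 0).exists
  have := hμ.eps_le_force (memLp_const 0)
  simp at this
  linarith

/-- NATURAL STRENGTHENING 3 (refuted): `QuarticGate` with an energy budget below the force floor,
`‖f‖_{L²} √E < ε`. -/
def QuarticGateSubFloor : Prop :=
  ∃ f : UnitAddTorus (Fin 3) → EuclideanSpace ℝ (Fin 3),
    Torus.IsSmooth f ∧ Torus.IsDivFree f ∧ Torus.HasZeroMean f ∧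
    ∃ (ν : ℕ → ℝ) (E ε : ℝ), (∀ j, 0 < ν j) ∧ Tendsto ν atTop (𝓝 0) ∧ 0 < ε ∧
    Real.sqrt (∫ x, ‖f x‖ ^ 2) * Real.sqrt E < ε ∧
    ∀ j : ℕ, ∃ᶠ N in atTop, ∃ μ, IsQuarticWitness f (ν j) N E ε μ

/-- **`¬ QuarticGateSubFloor`**: by the energy row, `ε ≤ ‖f‖_{L²}√E` for every witness. Tight: for
genuine steady states `ν‖∇u‖² = (f,u)` and Kolmogorov laminar flow has `(f,u) = ‖f‖‖u‖`. [folklore] -/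
theorem not_quarticGateSubFloor : ¬ QuarticGateSubFloor := by
  rintro ⟨f, hfs, -, -, ν, E, ε, hν, -, hε, hlt, hj⟩
  obtain ⟨N, μ, hμ⟩ := (hj 0).exists
  have := hμ.eps_le_force (hfs.memLp 2)
  linarith

end EnergyRow


/-! ## D. The laminar Kolmogorov family: the energy ceiling is load-bearing, and (C) is tight -/

section Laminar

/-- Local notation for the real Hilbert space `L²(T³; ℝ³)`. -/
local notation "L2T3" => Lp (EuclideanSpace ℝ (Fin 3)) 2 (volume : Measure (UnitAddTorus (Fin 3)))

/-- The Kolmogorov frequency `e₁ = (0,1,0)`. -/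
def kolFreq : Fin 3 → ℤ := Pi.single 1 1

/-- The symmetric frequency pair `{e₁, −e₁}`. -/
def kolSet : Finset (Fin 3 → ℤ) := {kolFreq, -kolFreq}

/-- The coefficient family of `a cos(2πx₁) e₀`: the constant `(a/2) e₀`. -/
def kolCoeff (a : ℝ) : (Fin 3 → ℤ) → EuclideanSpace ℂ (Fin 3) :=
  fun _ => ((a / 2 : ℝ) : ℂ) • EuclideanSpace.complexify (EuclideanSpace.single (0 : Fin 3) (1 : ℝ))

/-- The Kolmogorov (laminar shear) field `K_a(x) = a cos(2πx₁) e₀` on `T³`. -/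
def kolField (a : ℝ) : UnitAddTorus (Fin 3) → EuclideanSpace ℝ (Fin 3) :=
  Torus.realTrigPoly kolSet (kolCoeff a)

theorem kolFreq_ne_zero : kolFreq ≠ 0 := fun h => by
  have := congrFun h 1; simp [kolFreq] at this

theorem kolFreq_apply_zero : kolFreq 0 = 0 := by simp [kolFreq]

theorem freqNormSq_kolFreq : Torus.freqNormSq kolFreq = 1 := by
  simp [Torus.freqNormSq, kolFreq, Fin.sum_univ_three]

theorem neg_mem_kolSet : ∀ k ∈ kolSet, -k ∈ kolSet := by
  intro k hk
  simp only [kolSet, Finset.mem_insert, Finset.mem_singleton] at hk ⊢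
  rcases hk with rfl | rfl <;> simp

theorem freqNormSq_of_mem_kolSet {k : Fin 3 → ℤ} (hk : k ∈ kolSet) : Torus.freqNormSq k = 1 := by
  simp only [kolSet, Finset.mem_insert, Finset.mem_singleton] at hk
  rcases hk with rfl | rfl
  · exact freqNormSq_kolFreq
  · rw [Torus.freqNormSq_neg]; exact freqNormSq_kolFreq

theorem ne_zero_of_mem_kolSet {k : Fin 3 → ℤ} (hk : k ∈ kolSet) : k ≠ 0 := by
  intro h; subst h
  have := freqNormSq_of_mem_kolSet hk
  rw [Torus.freqNormSq_zero] at this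
  exact zero_ne_one this

theorem apply_zero_of_mem_kolSet {k : Fin 3 → ℤ} (hk : k ∈ kolSet) : k 0 = 0 := by
  simp only [kolSet, Finset.mem_insert, Finset.mem_singleton] at hk
  rcases hk with rfl | rfl <;> simp [kolFreq]

theorem isConjSymm_kolCoeff (a : ℝ) : Torus.IsConjSymm (kolCoeff a) := by
  intro k
  simp only [kolCoeff]
  rw [EuclideanSpace.conjVec_smul, EuclideanSpace.conjVec_complexify, Complex.conj_ofReal]

theorem isTransversal_kolCoeff (a : ℝ) : Torus.IsTransversal kolSet (kolCoeff a) := by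
  intro k hk
  simp [kolCoeff, EuclideanSpace.complexify_apply, Fin.sum_univ_three, apply_zero_of_mem_kolSet hk]

theorem norm_kolCoeff (a : ℝ) (k : Fin 3 → ℤ) : ‖kolCoeff a k‖ = |a| / 2 := by
  simp only [kolCoeff, norm_smul, Complex.norm_real, Real.norm_eq_abs,
    EuclideanSpace.norm_complexify, PiLp.norm_single, norm_one, mul_one, abs_div,
    abs_two]

theorem kolCoeff_mul (r a : ℝ) : kolCoeff (r * a) = fun k => ((r : ℝ) : ℂ) • kolCoeff a k := by
  funext k
  simp only [kolCoeff, smul_smul, ← Complex.ofReal_mul]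
  ring_nf

/-- `K_a` is smooth. [folklore] -/
theorem isSmooth_kolField (a : ℝ) : Torus.IsSmooth (kolField a) :=
  Torus.isSmooth_realTrigPoly _ _

/-- `K_a` is divergence free. [folklore] -/
theorem isDivFree_kolField (a : ℝ) : Torus.IsDivFree (kolField a) :=
  Torus.isDivFree_realTrigPoly (isTransversal_kolCoeff a)

/-- `K_a` has zero mean. [folklore] -/
theorem hasZeroMean_kolField (a : ℝ) : Torus.HasZeroMean (kolField a) := by
  unfold Torus.HasZeroMean kolField
  simp_rw [Torus.realTrigPoly_apply_eq_sum]
  rw [integral_finsetSum _ fun k _ => ?_]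
  · refine Finset.sum_eq_zero fun k hk => ?_
    have hi : Integrable (fun x : UnitAddTorus (Fin 3) => UnitAddTorus.mFourier k x • kolCoeff a k) volume :=
      ((UnitAddTorus.mFourier k).continuous.smul continuous_const).integrable_unitAddTorus
    rw [ContinuousLinearMap.integral_comp_comm _ hi, integral_smul_const, Torus.integral_mFourier,
      if_neg (ne_zero_of_mem_kolSet hk), zero_smul, map_zero]
  · exact (EuclideanSpace.realPart.continuous.comp
      ((UnitAddTorus.mFourier k).continuous.smul continuous_const)).integrable_unitAddTorus

/-- `K_{ra} = r K_a`. [folklore] -/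
theorem kolField_mul (r a : ℝ) (x : UnitAddTorus (Fin 3)) : kolField (r * a) x = r • kolField a x := by
  simp only [kolField, Torus.realTrigPoly_apply_eq_sum, kolCoeff_mul, Finset.smul_sum]
  refine Finset.sum_congr rfl fun k _ => ?_
  rw [← map_smul, smul_comm, Complex.coe_smul]

/-- `ΔK_a = −4π² K_a`. [folklore] -/
theorem laplacian_kolField (a : ℝ) (x : UnitAddTorus (Fin 3)) :
    Torus.laplacian (kolField a) x = -(4 * Real.pi ^ 2) • kolField a x := by
  rw [kolField, Torus.laplacian_realTrigPoly, show -(4 * Real.pi ^ 2) • Torus.realTrigPoly kolSet (kolCoeff a) x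
    = kolField (-(4 * Real.pi ^ 2) * a) x from (kolField_mul _ _ x).symm, kolField]
  refine congrFun (Torus.realTrigPoly_congr fun k hk => ?_) x
  rw [kolCoeff_mul, freqNormSq_of_mem_kolSet hk]
  simp

/-- `∂₀ K_a = 0` (the field does not depend on `x₀`). [folklore] -/
theorem partialDeriv_zero_kolField (a : ℝ) : Torus.partialDeriv 0 (kolField a) = 0 := by
  rw [kolField, Torus.partialDeriv_realTrigPoly', ← Torus.realTrigPoly_zero kolSet]
  refine Torus.realTrigPoly_congr fun k hk => ?_
  simp [apply_zero_of_mem_kolSet hk]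

/-- The components `i ≠ 0` of `K_a` vanish. [folklore] -/
theorem kolField_apply_of_ne (a : ℝ) (x : UnitAddTorus (Fin 3)) {i : Fin 3} (hi : i ≠ 0) :
    kolField a x i = 0 := by
  rw [kolField, Torus.realTrigPoly_apply_coord, Torus.trigPoly_apply]
  simp [kolCoeff, EuclideanSpace.complexify_apply, hi.symm]

/-- `(K_a·∇)K_a = 0`: laminar shear has no self-advection. [folklore] -/
theorem convect_kolField_self (a : ℝ) (x : UnitAddTorus (Fin 3)) :
    Torus.convect (kolField a) (kolField a) x = 0 := by
  rw [Torus.convect, Torus.fderiv_apply_eq_sum_partialDeriv ((isSmooth_kolField a).isContDiff (by simp))]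
  refine Finset.sum_eq_zero fun i _ => ?_
  by_cases hi : i = 0
  · subst hi; rw [partialDeriv_zero_kolField]; simp
  · rw [kolField_apply_of_ne a x hi, zero_smul]

/-- **Laminar Kolmogorov flow is an exact steady state at every viscosity**: for every smooth test
field `w`, `⟨F(U), w⟩ = 0` where `U ∈ H` is the class of `K_a` and the force is `4π²ν K_a`
(`νΔK_a + f = 0`, `(K_a·∇)K_a = 0`, and `b(K,K,w) = −b(K,w,K)`). [folklore] -/
theorem nsGeneratorPairing_kolField {ν a : ℝ} {U : Torus.energySpace (Fin 3)}
    (hU : ((U.1 : L2T3) : UnitAddTorus (Fin 3) → EuclideanSpace ℝ (Fin 3)) =ᵐ[volume] kolField a)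
    {w : UnitAddTorus (Fin 3) → EuclideanSpace ℝ (Fin 3)} (hw : Torus.IsSmooth w) :
    Torus.nsGeneratorPairing ν (kolField (4 * Real.pi ^ 2 * ν * a)) U w = 0 := by
  have hK := isSmooth_kolField a
  have hf := isSmooth_kolField (4 * Real.pi ^ 2 * ν * a)
  rw [Torus.nsGeneratorPairing_eq_flux ν (hf.memLp 2) hw hU]
  have hi1 : Integrable (fun x => ⟪kolField a x, Torus.convect (kolField a) w x⟫_ℝ) volume :=
    (hK.continuous.inner (hK.convect hw).continuous).integrable_unitAddTorus
  have hi2 : Integrable (fun x => ν * ⟪kolField a x, Torus.laplacian w x⟫_ℝ) volume :=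
    ((hK.continuous.inner hw.laplacian.continuous).integrable_unitAddTorus).const_mul ν
  have hi3 : Integrable (fun x => ⟪kolField (4 * Real.pi ^ 2 * ν * a) x, w x⟫_ℝ) volume :=
    (hf.continuous.inner hw.continuous).integrable_unitAddTorus
  have hi12 : Integrable (fun x => ⟪kolField a x, Torus.convect (kolField a) w x⟫_ℝ +
      ν * ⟪kolField a x, Torus.laplacian w x⟫_ℝ) volume := hi1.add hi2
  rw [integral_add hi12 hi3, integral_add hi1 hi2, integral_const_mul]
  -- the transport term
  have h1 : ∫ x, ⟪kolField a x, Torus.convect (kolField a) w x⟫_ℝ = 0 := by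
    have h := Torus.integral_inner_convect_add_eq_zero hK (isDivFree_kolField a) hK hw
    have h0 : ∫ x, ⟪Torus.convect (kolField a) (kolField a) x, w x⟫_ℝ = 0 := by
      simp_rw [convect_kolField_self, inner_zero_left, integral_zero]
    linarith
  -- the Stokes term
  have h2 : ∫ x, ⟪kolField a x, Torus.laplacian w x⟫_ℝ = -(4 * Real.pi ^ 2) * ∫ x, ⟪kolField a x, w x⟫_ℝ := by
    rw [← Torus.integral_inner_laplacian_comm hK hw]
    simp_rw [laplacian_kolField, inner_smul_left]
    rw [integral_const_mul]
    simp
  -- the force term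
  have h3 : ∫ x, ⟪kolField (4 * Real.pi ^ 2 * ν * a) x, w x⟫_ℝ =
      (4 * Real.pi ^ 2 * ν) * ∫ x, ⟪kolField a x, w x⟫_ℝ := by
    simp_rw [kolField_mul, inner_smul_left]
    rw [integral_const_mul]
    simp
  rw [h1, h2, h3]
  ring

theorem kolFreq_ne_neg : kolFreq ≠ -kolFreq := fun h => by
  have := congrFun h 1; simp [kolFreq] at this

theorem card_kolSet : kolSet.card = 2 := by
  rw [kolSet, Finset.card_insert_of_notMem (by simpa using kolFreq_ne_neg), Finset.card_singleton]

/-- `‖∇K_a‖² = 2π²a²`. [folklore] -/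
theorem toReal_eGradNormSq_kolField (a : ℝ) :
    (Torus.eGradNormSq (kolField a)).toReal = 2 * Real.pi ^ 2 * a ^ 2 := by
  rw [kolField, Torus.toReal_eGradNormSq_realTrigPoly neg_mem_kolSet (isConjSymm_kolCoeff a),
    Finset.sum_congr rfl fun k hk => by rw [freqNormSq_of_mem_kolSet hk, norm_kolCoeff],
    Finset.sum_const, card_kolSet]
  simp only [nsmul_eq_mul, Nat.cast_ofNat, one_mul, div_pow, sq_abs]
  ring

/-- `∫ ‖K_a‖² = a²/2`. [folklore] -/
theorem integral_norm_sq_kolField (a : ℝ) : ∫ x, ‖kolField a x‖ ^ 2 = a ^ 2 / 2 := by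
  rw [kolField, Torus.integral_norm_sq_realTrigPoly neg_mem_kolSet (isConjSymm_kolCoeff a),
    Finset.sum_congr rfl fun k _ => by rw [norm_kolCoeff], Finset.sum_const, card_kolSet]
  simp only [nsmul_eq_mul, Nat.cast_ofNat, div_pow, sq_abs]
  ring

/-- The class of `K_a` in the energy space `H`. -/
def kolState (a : ℝ) : Torus.energySpace (Fin 3) :=
  ⟨((isSmooth_kolField a).memLp 2).toLp (kolField a),
    Torus.smoothSolenoidal_subset_energySpace ⟨kolField a, isSmooth_kolField a,
      isDivFree_kolField a, hasZeroMean_kolField a, MemLp.coeFn_toLp _⟩⟩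

theorem coe_kolState_ae (a : ℝ) :
    (((kolState a).1 : L2T3) : UnitAddTorus (Fin 3) → EuclideanSpace ℝ (Fin 3)) =ᵐ[volume] kolField a :=
  MemLp.coeFn_toLp ((isSmooth_kolField a).memLp 2)

/-- Fourier coefficients only see the a.e. class. [folklore] -/
theorem mFourierCoeff_congr_ae {v w : UnitAddTorus (Fin 3) → EuclideanSpace ℝ (Fin 3)}
    (h : v =ᵐ[volume] w) (k : Fin 3 → ℤ) :
    UnitAddTorus.mFourierCoeff (EuclideanSpace.complexify ∘ v) k =
      UnitAddTorus.mFourierCoeff (EuclideanSpace.complexify ∘ w) k := by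
  rw [Torus.mFourierCoeff_eq_integral_volume, Torus.mFourierCoeff_eq_integral_volume]
  exact integral_congr_ae (h.mono fun x hx => by simp [hx])

/-- The spectral enstrophy only sees the a.e. class. [folklore] -/
theorem eGradNormSq_congr_ae {v w : UnitAddTorus (Fin 3) → EuclideanSpace ℝ (Fin 3)}
    (h : v =ᵐ[volume] w) : Torus.eGradNormSq v = Torus.eGradNormSq w := by
  rw [Torus.eGradNormSq_eq_tsum, Torus.eGradNormSq_eq_tsum]
  simp_rw [mFourierCoeff_congr_ae h]

/-- `K_a` is a level-`1` (hence level-`N`, `N ≥ 1`) field. [folklore] -/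
theorem isLevel_kolState (a : ℝ) {N : ℕ} (hN : 1 ≤ N) : IsLevel N (kolState a) := by
  intro k hk
  rw [mFourierCoeff_congr_ae (coe_kolState_ae a), kolField]
  have hk' : k ∉ kolSet := fun hkS => hk (Finset.mem_erase.2 ⟨ne_zero_of_mem_kolSet hkS,
    Torus.mem_freqBall.2 (by
      rw [freqNormSq_of_mem_kolSet hkS]
      have : (1 : ℝ) ≤ N := by exact_mod_cast hN
      nlinarith)⟩)
  have hnk' : -k ∉ kolSet := fun h => hk' (by simpa using neg_mem_kolSet _ h)
  exact Torus.mFourierCoeff_realTrigPoly_eq_zero_of_not_mem _ hk' hnk'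

/-- `‖[K_a]‖²_H = a²/2`. [folklore] -/
theorem norm_sq_kolState (a : ℝ) : ‖kolState a‖ ^ 2 = a ^ 2 / 2 := by
  have h : ‖kolState a‖ = ‖((kolState a).1 : L2T3)‖ := rfl
  rw [h, ← Torus.integral_norm_sq_coe_eq, ← integral_norm_sq_kolField a]
  exact integral_congr_ae ((coe_kolState_ae a).mono fun x hx => by simp [hx])

/-- **The laminar Dirac is stationary at EVERY order**: all rows of `δ_{[K_a]}` at force
`4π²ν K_a` vanish (any level `N`, any degree `d`). [folklore] -/
theorem isPolyStationary_dirac_kolState (ν a : ℝ) (N d : ℕ) :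
    IsPolyStationary ν (kolField (4 * Real.pi ^ 2 * ν * a)) N d (Measure.dirac (kolState a)) := by
  haveI : MeasurableSingletonClass (Torus.energySpace (Fin 3)) :=
    OpensMeasurableSpace.toMeasurableSingletonClass
  intro m g P hg _
  refine ⟨Torus.integrable_dirac _ _, ?_⟩
  rw [integral_dirac]
  exact nsGeneratorPairing_kolField (coe_kolState_ae a)
    (Torus.isSmooth_sum_smul Finset.univ _ fun i _ => (hg i).1)

/-- Dissipation of the laminar Dirac: `ν‖∇K_a‖² = 2π²νa²`. [folklore] -/
theorem ensembleDissipation_dirac_kolState (ν a : ℝ) :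
    Torus.ensembleDissipation ν (Measure.dirac (kolState a)) = ν * (2 * Real.pi ^ 2 * a ^ 2) := by
  haveI : MeasurableSingletonClass (Torus.energySpace (Fin 3)) :=
    OpensMeasurableSpace.toMeasurableSingletonClass
  unfold Torus.ensembleDissipation Torus.ensembleEnstrophy
  rw [lintegral_dirac, eGradNormSq_congr_ae (coe_kolState_ae a), toReal_eGradNormSq_kolField]

/-- Energy of the laminar Dirac: `a²/2`. [folklore] -/
theorem ensembleEnergy_dirac_kolState (a : ℝ) :
    Torus.ensembleEnergy (Measure.dirac (kolState a)) = a ^ 2 / 2 := by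
  haveI : MeasurableSingletonClass (Torus.energySpace (Fin 3)) :=
    OpensMeasurableSpace.toMeasurableSingletonClass
  rw [Torus.ensembleEnergy, integral_dirac, norm_sq_kolState]

/-- The laminar Dirac at amplitude `a = (4π²ν)⁻¹` is a witness for the force `K_1` at every level
`N ≥ 1`, with energy `a²/2` and dissipation `(8π²ν)⁻¹` — and it ATTAINS the force floor of (C):
`‖K_1‖₂ √(a²/2) = (8π²ν)⁻¹`. [folklore] -/
theorem isQuarticWitness_dirac_kolState {ν : ℝ} (hν : 0 < ν) {N : ℕ} (hN : 1 ≤ N) :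
    IsQuarticWitness (kolField 1) ν N ((4 * Real.pi ^ 2 * ν)⁻¹ ^ 2 / 2) (8 * Real.pi ^ 2 * ν)⁻¹
      (Measure.dirac (kolState (4 * Real.pi ^ 2 * ν)⁻¹)) ∧
    Real.sqrt (∫ x, ‖kolField 1 x‖ ^ 2) * Real.sqrt ((4 * Real.pi ^ 2 * ν)⁻¹ ^ 2 / 2) =
      (8 * Real.pi ^ 2 * ν)⁻¹ := by
  haveI : MeasurableSingletonClass (Torus.energySpace (Fin 3)) :=
    OpensMeasurableSpace.toMeasurableSingletonClass
  have hpi : 0 < Real.pi := Real.pi_pos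
  set a : ℝ := (4 * Real.pi ^ 2 * ν)⁻¹ with ha
  have ha0 : 0 < a := by positivity
  have hforce : kolField 1 = kolField (4 * Real.pi ^ 2 * ν * a) := by
    rw [ha, mul_inv_cancel₀ (by positivity)]
  refine ⟨⟨inferInstance, ?_, Torus.integrable_dirac _ _, ?_, ?_, ?_⟩, ?_⟩
  · rw [ae_dirac_eq]; simpa using isLevel_kolState a hN
  · rw [hforce]; exact isPolyStationary_dirac_kolState ν a N 4
  · rw [ensembleEnergy_dirac_kolState]
  · rw [ensembleDissipation_dirac_kolState, ha]
    field_simp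
    ring_nf
    exact le_rfl
  · rw [integral_norm_sq_kolField, ← Real.sqrt_mul (by positivity), show
      (1 : ℝ) ^ 2 / 2 * (a ^ 2 / 2) = (a / 2) ^ 2 by ring, Real.sqrt_sq (by positivity), ha]
    field_simp
    ring

/-- WEAKENING 2 (holds trivially): `QuarticGate` without the energy ceiling `ensembleEnergy μ ≤ E`
(everything else kept, stationarity even at every order). -/
def QuarticGateWithoutEnergyCeiling : Prop :=
  ∃ f : UnitAddTorus (Fin 3) → EuclideanSpace ℝ (Fin 3),
    Torus.IsSmooth f ∧ Torus.IsDivFree f ∧ Torus.HasZeroMean f ∧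
    ∃ (ν : ℕ → ℝ) (ε : ℝ), (∀ j, 0 < ν j) ∧ Tendsto ν atTop (𝓝 0) ∧ 0 < ε ∧
    ∀ j : ℕ, ∃ᶠ N in atTop, ∃ μ : Measure (Torus.energySpace (Fin 3)),
      IsProbabilityMeasure μ ∧ (∀ᵐ u ∂μ, IsLevel N u) ∧
      Integrable (fun u : Torus.energySpace (Fin 3) => ‖u‖ ^ 4) μ ∧
      (∀ d, IsPolyStationary (ν j) f N d μ) ∧ ε ≤ Torus.ensembleDissipation (ν j) μ

/-- **The energy ceiling is load-bearing**: without it, the laminar Kolmogorov Diracs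
`δ_{K_1/(4π²ν_j)}` (exact steady states at EVERY order, level 1, dissipation `(8π²ν_j)⁻¹ → ∞`)
witness the statement for the fixed force `K_1 = cos(2πx₁)e₀`. Any proof of `QuarticGate` must use
`ensembleEnergy μ ≤ E` quantitatively (through (C): `E ≥ (ε/‖f‖₂)²`). [folklore] -/
theorem quarticGateWithoutEnergyCeiling_holds : QuarticGateWithoutEnergyCeiling := by
  haveI : MeasurableSingletonClass (Torus.energySpace (Fin 3)) :=
    OpensMeasurableSpace.toMeasurableSingletonClass
  have hpi : 0 < Real.pi := Real.pi_pos
  refine ⟨kolField 1, isSmooth_kolField 1, isDivFree_kolField 1, hasZeroMean_kolField 1,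
    fun j => 1 / ((j : ℝ) + 1), (8 * Real.pi ^ 2)⁻¹, fun j => by positivity,
    tendsto_one_div_add_atTop_nhds_zero_nat, by positivity, fun j => ?_⟩
  refine (eventually_ge_atTop 1).frequently.mono fun N hN => ?_
  set ν : ℝ := 1 / ((j : ℝ) + 1) with hν
  have hν0 : 0 < ν := by positivity
  have hν1 : ν ≤ 1 := by
    rw [hν, div_le_one (by positivity)]; linarith [(Nat.cast_nonneg j : (0 : ℝ) ≤ j)]
  set a : ℝ := (4 * Real.pi ^ 2 * ν)⁻¹ with ha
  have hforce : kolField 1 = kolField (4 * Real.pi ^ 2 * ν * a) := by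
    rw [ha, mul_inv_cancel₀ (by positivity)]
  refine ⟨Measure.dirac (kolState a), inferInstance, ?_, Torus.integrable_dirac _ _, ?_, ?_⟩
  · rw [ae_dirac_eq]; simpa using isLevel_kolState a hN
  · intro d; rw [hforce]; exact isPolyStationary_dirac_kolState ν a N d
  · rw [ensembleDissipation_dirac_kolState, ha]
    have h1 : ν * (2 * Real.pi ^ 2 * ((4 * Real.pi ^ 2 * ν)⁻¹) ^ 2) = (8 * Real.pi ^ 2 * ν)⁻¹ := by
      field_simp; ring
    rw [h1]
    exact inv_anti₀ (by positivity) (by nlinarith [hν1, hpi])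

end Laminar


/-! ## E. What a refutation must prove, and the order-3 shadow -/

section Shape

/-- **`¬ QuarticGate` unfolded**: a refutation is a UNIFORM-IN-`N` QUIETNESS THEOREM — for every
admissible force, every positive `ν_j → 0` and all budgets `E`, `ε > 0`, some viscosity `ν_j` admits,
for all but finitely many levels `N`, no loud 4-stationary level-`N` law. (Open; believed false — it
would be a Galerkin-ensemble "no zeroth law" at SOS degree 4.) [folklore] -/
theorem not_quarticGate_iff :
    ¬ QuarticGate ↔ ∀ f : UnitAddTorus (Fin 3) → EuclideanSpace ℝ (Fin 3),
      Torus.IsSmooth f → Torus.IsDivFree f → Torus.HasZeroMean f →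
      ∀ (ν : ℕ → ℝ) (E ε : ℝ), (∀ j, 0 < ν j) → Tendsto ν atTop (𝓝 0) → 0 < ε →
      ∃ j : ℕ, ∀ᶠ N in atTop, ∀ μ, ¬ IsQuarticWitness f (ν j) N E ε μ := by
  rw [quarticGate_iff]
  simp only [not_exists, not_and, not_forall, Filter.not_frequently]

/-- The order-`d` shadow of a witness: a `d'`-stationary law is `d`-stationary for `d ≤ d'`. [folklore] -/
theorem IsPolyStationary.mono {ν : ℝ} {f : UnitAddTorus (Fin 3) → EuclideanSpace ℝ (Fin 3)} {N d d' : ℕ}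
    {μ : Measure (Torus.energySpace (Fin 3))} (h : IsPolyStationary ν f N d' μ) (hd : d ≤ d') :
    IsPolyStationary ν f N d μ :=
  fun m g P hg hP => h m g P hg (hP.trans hd)

/-- The ORDER-3 SHADOW of the crux (3-stationarity, finite fourth moments kept): `QuarticGate` implies
it trivially, so any kill of the shadow — a quietness certificate using rows of degree `≤ 2` only,
i.e. linear rows + the two quadratic Casimir rows (energy, helicity) in 3-D — kills the crux. In 2-D the
enstrophy row is such a certificate (`PlanarCubicQuiet`); in 3-D none is known (`CubicParityLoud`). -/
def CubicShadow : Prop :=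
  ∃ f : UnitAddTorus (Fin 3) → EuclideanSpace ℝ (Fin 3),
    Torus.IsSmooth f ∧ Torus.IsDivFree f ∧ Torus.HasZeroMean f ∧
    ∃ (ν : ℕ → ℝ) (E ε : ℝ), (∀ j, 0 < ν j) ∧ Tendsto ν atTop (𝓝 0) ∧ 0 < ε ∧
    ∀ j : ℕ, ∃ᶠ N in atTop, ∃ μ : Measure (Torus.energySpace (Fin 3)),
      IsProbabilityMeasure μ ∧ (∀ᵐ u ∂μ, IsLevel N u) ∧
      Integrable (fun u : Torus.energySpace (Fin 3) => ‖u‖ ^ 4) μ ∧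
      IsPolyStationary (ν j) f N 3 μ ∧ Torus.ensembleEnergy μ ≤ E ∧ ε ≤ Torus.ensembleDissipation (ν j) μ

/-- `QuarticGate → CubicShadow`. [folklore] -/
theorem cubicShadow_of_quarticGate (h : QuarticGate) : CubicShadow := by
  obtain ⟨f, hfs, hfd, hfz, ν, E, ε, hν, hν0, hε, hj⟩ := quarticGate_iff.1 h
  refine ⟨f, hfs, hfd, hfz, ν, E, ε, hν, hν0, hε, fun j => (hj j).mono ?_⟩
  rintro N ⟨μ, hp, hl, h4, hst, hE, hD⟩
  exact ⟨μ, hp, hl, h4, hst.mono (by norm_num), hE, hD⟩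

end Shape


/-! ## F. (cycle 2) `ν_j → 0` is load-bearing: at fixed viscosity the laminar Dirac is loud -/

section FixedViscosity

/-- WEAKENING 3 (holds trivially): `QuarticGate` without `Tendsto ν atTop (𝓝 0)` (positivity of
the viscosities, `0 < ε`, the energy ceiling and 4-stationarity all kept). -/
def QuarticGateWithoutVanishingViscosity : Prop :=
  ∃ f : UnitAddTorus (Fin 3) → EuclideanSpace ℝ (Fin 3),
    Torus.IsSmooth f ∧ Torus.IsDivFree f ∧ Torus.HasZeroMean f ∧
    ∃ (ν : ℕ → ℝ) (E ε : ℝ), (∀ j, 0 < ν j) ∧ 0 < ε ∧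
    ∀ j : ℕ, ∃ᶠ N in atTop, ∃ μ, IsQuarticWitness f (ν j) N E ε μ

/-- **`ν_j → 0` is load-bearing**: at a FIXED viscosity (`ν_j ≡ 1`) the laminar Kolmogorov Dirac
`δ_{K_{1/(4π²)}}` (section D) is a witness for the force `K_1` at every level `N ≥ 1`, with
`E = (4π²)⁻²/2` and `ε = (8π²)⁻¹ > 0`. Together with (A) (levels must escape like `ν_j^{-1/2}`),
(B) (`0 < ε`), (C) (`∃ f`, `E ≥ (ε/‖f‖₂)²`) and (D) (energy ceiling) this completes the table:
EVERY clause of the crux is necessary for non-triviality, and any proof must couple `N → ∞` with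
`ν_j → 0` at bounded energy: loudness at energy `≤ E` forces mean enstrophy `≥ ε/ν_j`, carried (by (A))
at levels `N ≳ (ε/(4π²ν_jE))^{1/2}` — the witnesses are genuinely multi-scale families, never bounded-level
perturbations of laminar states. -/
theorem quarticGateWithoutVanishingViscosity_holds : QuarticGateWithoutVanishingViscosity := by
  refine ⟨kolField 1, isSmooth_kolField 1, isDivFree_kolField 1, hasZeroMean_kolField 1,
    fun _ => 1, (4 * Real.pi ^ 2 * 1)⁻¹ ^ 2 / 2, (8 * Real.pi ^ 2 * 1)⁻¹, fun _ => one_pos,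
    by positivity, fun j => ?_⟩
  exact (eventually_ge_atTop 1).frequently.mono fun N hN =>
    ⟨_, (isQuarticWitness_dirac_kolState one_pos hN).1⟩

/-- The fixed-viscosity witnesses above are EXACT steady states, hence stationary at every order:
the weakening stays true with `4` replaced by any `d` (all polynomial rows vanish). -/
theorem exists_loud_dirac_polyStationary_all_orders {ν : ℝ} (hν : 0 < ν) {N : ℕ} (hN : 1 ≤ N) (d : ℕ) :
    ∃ μ : Measure (Torus.energySpace (Fin 3)), IsProbabilityMeasure μ ∧ (∀ᵐ u ∂μ, IsLevel N u) ∧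
      IsPolyStationary ν (kolField 1) N d μ ∧
      Torus.ensembleEnergy μ = (4 * Real.pi ^ 2 * ν)⁻¹ ^ 2 / 2 ∧
      Torus.ensembleDissipation ν μ = (8 * Real.pi ^ 2 * ν)⁻¹ := by
  haveI : MeasurableSingletonClass (Torus.energySpace (Fin 3)) :=
    OpensMeasurableSpace.toMeasurableSingletonClass
  have hpi : 0 < Real.pi := Real.pi_pos
  set a : ℝ := (4 * Real.pi ^ 2 * ν)⁻¹ with ha
  have hforce : kolField 1 = kolField (4 * Real.pi ^ 2 * ν * a) := by
    rw [ha, mul_inv_cancel₀ (by positivity)]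
  refine ⟨Measure.dirac (kolState a), inferInstance, ?_, ?_, ensembleEnergy_dirac_kolState a, ?_⟩
  · rw [ae_dirac_eq]; simpa using isLevel_kolState a hN
  · rw [hforce]; exact isPolyStationary_dirac_kolState ν a N d
  · rw [ensembleDissipation_dirac_kolState, ha]
    field_simp
    ring

end FixedViscosity


/-! ## G. (cycle 2) The lead's stubs S1–S6 (line `recession-cone`, skeleton sha b49af609…):
named conjuncts of S2 and what is CERTIFIED about them by exact computation

`stub_casimirs` is `∃ᶠ N, NoCubicCasimir N ∧ QuadRigidity N` with the two predicates below
(verbatim conjuncts). Exact rank computations over `𝔽_p` (p = 999983) of the graded invariance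
systems (script `casimir/main.py` of the cdisprove g2 seat; translation covariance grades polynomial
invariants of Galerkin–Euler by total momentum `θ ∈ ℤ³`, `O_h` permutes the sectors; rank over
`𝔽_p` of a random-evaluation matrix can only UNDER-estimate the true rank, and `E`, `H` are genuine
invariants, so "computed quadratic nullity 2" PROVES `QuadRigidity`-as-dimension-count and
"computed cubic nullity 0" PROVES `NoCubicCasimir`, modulo the correctness of the 300-line script):

* quadratic invariants of the ball truncation `0 < |k|² ≤ M` have dimension EXACTLY 2 (`= span{E,H}`,
  all in the sector `θ = 0`) for `M = 3, 4, 5, 6, 8, 9, 16` — i.e. at the typed levels `N = 2` (`M = 4`,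
  64 real dims), `N = 3` (`M = 9`, 244 real dims) and `N = 4` (`M = 16`, 512 real dims, 71 sectors); dimension 3 at `M = 2` (the known accident,
  not a typed level) and 78 = everything at `M = 1` (level `N = 1`: NO triads, `B_1 ≡ 0`);
* cubic invariants: dimension 0 for `M = 2, 3, 4` (exact mod p, all momentum sectors; `M = 4` = level
  `N = 2`, 30 sectors, 93 s — and independently 0 by the rattack seat's code, `casimir_evidence.txt`);
  `M = 5` is 0 too (46 sectors, exact, local); `M = 6, 9` as kit jobs j011084 / j011086 (queue saturated at the time of
  writing; results auto-attach to the item as evidence), `M = 25` quadratic as j011081 (`M = 16`: total 2, both locally and kit j011077, 71 sectors).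
  NET: `NoCubicCasimir 2 ∧ QuadRigidity 2` — S2 HOLDS AT THE TYPED LEVEL `N = 2` (exact; two independent
  codes agree on both halves); `QuadRigidity 3` and `QuadRigidity 4` hold (exact); `NoCubicCasimir 3` pending (j011086).

THE ACCIDENT AT `M = 2` (18 wavevectors `±eᵢ`, `±eᵢ±eⱼ`), extracted from the exact null space
(`casimir/nullvec.py`): besides `E` and `H`, the IN-PLANE POLARISATION ENERGY OF THE SHELL `|k|² = 2`,
`Q_acc = Σ_{|k|²=2} |û(k)·ê(k)|²` with `ê(k)` the unit vector of the coordinate plane of `k` perpendicular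
to `k` (e.g. `ê(1,1,0) ∝ (1,−1,0)`), is conserved by the 18-mode system; it dies at `M = 3` when the modes
`(±1,±1,±1) = (1,1,0) + (0,0,1)` (unequal-length pairs) enter. Mechanism (a SELECTION RULE worth knowing
for any proof of S2): a pair `(r,s)` with `|r| = |s|` feeds `k = r+s` only in the polarisation `r×s`
orthogonal to the plane of the pair: `k⊥ = span{r−s, r×s}` when `|r| = |s|`, and the `(r−s)`-component
of the two symmetrised transfer terms is `(k·û(r))(û(s)·(r−s)) + (k·û(s))(û(r)·(r−s)) =
(s·û(r))(r·û(s)) − (r·û(s))(s·û(r)) = 0` (transversality `r·û(r) = s·û(s) = 0`); an isolated equal-length triad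
therefore constrains an off-diagonal block `A(k,·)` of a candidate quadratic Casimir only in ONE
polarisation of `k`. Generic large balls have enough unequal-length triads through every mode; the
computation confirms `span{E,H}` exactly for `M = 3,…,9`.

A BLOCK-KILLING LEMMA FOR S2 (ii) (paper, offered to the lead; the flip side of the selection rule). Grade a
candidate quadratic Casimir by momentum, `Q_θ = Σ_{k+k'=θ} û(k)ᵀA(k,k')û(k')` (`A(k,k') = P_k A(k,k') P_{k'}`,
`A(k,k') = A(k',k)ᵀ`); each `Q_θ` is invariant separately (Galerkin–Euler commutes with translations). For
`a ∦ b` transverse amplitudes give `{(b·û(a))û(b) + (a·û(b))û(a)} = span{n, (a−b)×n}`, `n = a×b`, whose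
projection to `(a+b)⊥` is `span{n, (|a|²−|b|²)(a+b)×n}` — ALL of `(a+b)⊥` iff `|a| ≠ |b|`. Hence: if
`a, b, a+b, c ∈ S_N`, `a ∦ b`, `|a| ≠ |b|`, `a+b+c = θ`, and the companion blocks `A(a+c, b)`, `A(b+c, a)`
vanish or are absent (`a+c ∉ S_N`, `b+c ∉ S_N`), then the coefficient of the monomials `û(a)û(b)û(c)` in
`{Q_θ, B_N} = 0` forces `A(a+b, c) = 0`. Companions are absent as soon as `a, b` lie in the crescent
`{x ∈ S_N : |θ − x| > N}`; an induction over the blocks of a sector `θ ≠ 0` ("crescent peeling") should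
empty every off-diagonal sector for `N ≥ 2`, leaving the diagonal sector `θ = 0`, where the same monomial
bookkeeping on triads `(a, b, −a−b)` relates `A(a,−a), A(b,−b), A(a+b,−a−b)` (Kraichnan's detailed
conservation, with polarisation mixing) and should give `A(k,−k) = αP_k + β(2πi k×)`. The exact counts above
say this programme cannot meet an obstruction below `M = 10`.

LOCAL VERSUS GLOBAL RIGIDITY (census, `casimir/census.py`, explicit wavevector sets, exact mod p; degrees
1 / 2 / 3): a single SCALENE triad `{±p,±q,±r}`, `p+q+r = 0` (12 real dims) carries 0 linear, 5 quadratic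
and 1 CUBIC invariant (three-wave structure: Manley–Rowe-type quadratics beyond `E, H`, and one cubic
Hamiltonian-like invariant); every ISOSCELES triad (`|p| = |q|`, right angle or not) carries 2 / 7 / 15 —
the two extra LINEAR Casimirs are the complex amplitude of the `(p−q)`-polarisation of the apex leg
`r = −(p+q)`, which the equal-length pair does not drive (the selection rule, `SelectionRule.lean`), and
they generate the surplus at degrees 2 and 3. Two scalene triads sharing one leg: 6 / 0 (quadratic / cubic);
a scalene chain of three: 3 / 0; pairs containing an isosceles triad: up to 15 / 40. The balls are clean:
`|k|² ≤ 4` has 0 / 2 / 0. So: CUBIC rigidity (`NoCubicCasimir`) is essentially LOCAL — two generically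
coupled triads already kill every cubic invariant — while QUADRATIC rigidity (`QuadRigidity`) is GLOBAL (the
connected triad network of the ball cuts 5-per-triad down to `span{E,H}`), and BOTH arguments must route
around isosceles sub-configurations, which locally carry linear Casimirs and their products.

Consequences for the line: (1) `stub_casimirs` is FALSE at `N = 1` (every polynomial is a Casimir
there; formal: section H) — harmless for `∃ᶠ N` but it pins the composition to `N ≥ 2`; (2) no accidental quadratic
Casimir and no cubic Casimir is visible through level 3, so the only refutation route of the crux
compatible with the line's reduction (`QuarticGate ⟸ S2` given S1, S3–S6, all of which I re-derived
and believe TRUE as typed) would need such accidents at ALL large `N` — implausible. The standing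
adversary's verdict after cycle 2: the crux AS TYPED is very probably TRUE (provable by the line);
its truth content is weaker than the card's quasi-normal gate (no flatness normalisation), see the
header. -/

section Stubs

/-- Conjunct (i) of `stub_casimirs` (verbatim): level-`N` Galerkin–Euler has no nonzero homogeneous
cubic polynomial invariant (cylindrical polynomial observables with level-`N` band tests). -/
def NoCubicCasimir (N : ℕ) : Prop :=
  ∀ (m : ℕ) (g : Fin m → UnitAddTorus (Fin 3) → EuclideanSpace ℝ (Fin 3))
    (P : MvPolynomial (Fin m) ℝ), (∀ i, IsBandTest N (g i)) → P.IsHomogeneous 3 →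
    (∀ u : Torus.energySpace (Fin 3), IsLevel N u →
      Torus.nsGeneratorPairing (d := Fin 3) 0 0 u (polyGrad g P u) = 0) →
    ∀ u : Torus.energySpace (Fin 3), IsLevel N u →
      MvPolynomial.eval (fun j => Torus.pairing u.1 (g j)) P = 0

/-- Conjunct (ii) of `stub_casimirs` (verbatim): QuadRigidity — every homogeneous quadratic
invariant of level-`N` Galerkin–Euler has gradient `2α P_N u + 2β curl P_N u`. -/
def QuadRigidity (N : ℕ) : Prop :=
  ∀ (m : ℕ) (g : Fin m → UnitAddTorus (Fin 3) → EuclideanSpace ℝ (Fin 3))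
    (P : MvPolynomial (Fin m) ℝ), (∀ i, IsBandTest N (g i)) → P.IsHomogeneous 2 →
    (∀ u : Torus.energySpace (Fin 3), IsLevel N u →
      Torus.nsGeneratorPairing (d := Fin 3) 0 0 u (polyGrad g P u) = 0) →
    ∃ α β : ℝ, ∀ u : Torus.energySpace (Fin 3), IsLevel N u →
      ∀ x, polyGrad g P u x =
        (2 * α) • Torus.fourierTruncate N (u.1 : UnitAddTorus (Fin 3) → EuclideanSpace ℝ (Fin 3)) x +
        (2 * β) • BDSV.curl (Torus.fourierTruncate N
          (u.1 : UnitAddTorus (Fin 3) → EuclideanSpace ℝ (Fin 3))) x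

/-- The shape of S2: `stub_casimirs` is literally `∃ᶠ N in atTop, NoCubicCasimir N ∧ QuadRigidity N`
(definitional; recorded so that targets can be named per level). -/
theorem stub_casimirs_shape :
    (∃ᶠ N in atTop, NoCubicCasimir N ∧ QuadRigidity N) ↔
    ∃ᶠ N in atTop,
    (∀ (m : ℕ) (g : Fin m → UnitAddTorus (Fin 3) → EuclideanSpace ℝ (Fin 3))
      (P : MvPolynomial (Fin m) ℝ), (∀ i, IsBandTest N (g i)) → P.IsHomogeneous 3 →
      (∀ u : Torus.energySpace (Fin 3), IsLevel N u →
        Torus.nsGeneratorPairing (d := Fin 3) 0 0 u (polyGrad g P u) = 0) →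
      ∀ u : Torus.energySpace (Fin 3), IsLevel N u →
        MvPolynomial.eval (fun j => Torus.pairing u.1 (g j)) P = 0) ∧
    (∀ (m : ℕ) (g : Fin m → UnitAddTorus (Fin 3) → EuclideanSpace ℝ (Fin 3))
      (P : MvPolynomial (Fin m) ℝ), (∀ i, IsBandTest N (g i)) → P.IsHomogeneous 2 →
      (∀ u : Torus.energySpace (Fin 3), IsLevel N u →
        Torus.nsGeneratorPairing (d := Fin 3) 0 0 u (polyGrad g P u) = 0) →
      ∃ α β : ℝ, ∀ u : Torus.energySpace (Fin 3), IsLevel N u →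
        ∀ x, polyGrad g P u x =
          (2 * α) • Torus.fourierTruncate N (u.1 : UnitAddTorus (Fin 3) → EuclideanSpace ℝ (Fin 3)) x +
          (2 * β) • BDSV.curl (Torus.fourierTruncate N
            (u.1 : UnitAddTorus (Fin 3) → EuclideanSpace ℝ (Fin 3))) x) :=
  Iff.rfl

end Stubs


/-! ## H. (cycle 2) LEVEL ONE IS INERT: `B_1 ≡ 0`, so both conjuncts of S2 FAIL at `N = 1`
(small-model refutation of the natural strengthening "`∀ N ≥ 1`" of `stub_casimirs`; certified copies LANDED as
`Theorems/QuarticGate/Negative/LevelOne.lean` p78686 + `LevelOneQuad.lean` p82396). Also: the Euler bracket of a level-`N` field against a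
band test in Fourier coefficients (`inertialPairing_eq_sum_convectionCoeff`, general `N`) — the bridge from
the `H`-level statements of S1/S2 to `Torus.convectionCoeff` bookkeeping, reusable by the lead. -/

section Coefficients

/-- Local notation for the real Hilbert space `L²(T³; ℝ³)`. -/
local notation "L2T3" => Lp (EuclideanSpace ℝ (Fin 3)) 2 (volume : Measure (UnitAddTorus (Fin 3)))

/-- Fourier coefficients `û(k)` of (the representative of) `u ∈ H`. -/
def coef (u : Torus.energySpace (Fin 3)) (k : Fin 3 → ℤ) : EuclideanSpace ℂ (Fin 3) :=
  UnitAddTorus.mFourierCoeff (EuclideanSpace.complexify ∘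
    ((u.1 : L2T3) : UnitAddTorus (Fin 3) → EuclideanSpace ℝ (Fin 3))) k

/-- Fourier coefficients `ŵ(k)` of a field `w : T³ → ℝ³`. -/
def tcoef (w : UnitAddTorus (Fin 3) → EuclideanSpace ℝ (Fin 3)) (k : Fin 3 → ℤ) :
    EuclideanSpace ℂ (Fin 3) :=
  UnitAddTorus.mFourierCoeff (EuclideanSpace.complexify ∘ w) k

/-- **The Euler bracket in Fourier coefficients.** For a level-`N` field `u ∈ H` and a smooth test
field `w` band-limited to the ball of radius `N`, the inertial pairing
`∫ (u ⊗ u) : ∇w = ∑_{|k| ≤ N} Re ⟪B̂_{k}(û, ŵ), û(k)⟫_ℂ` with the convection symbol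
`B̂_k(û, ŵ) = ∑_{l+m=k} (2πi û(l)·m) ŵ(m)` (`Torus.convectionCoeff`). [folklore] -/
theorem inertialPairing_eq_sum_convectionCoeff {N : ℕ} (u : Torus.energySpace (Fin 3))
    (hu : IsLevel N u) {w : UnitAddTorus (Fin 3) → EuclideanSpace ℝ (Fin 3)} (hw : Torus.IsSmooth w)
    (hwb : ∀ k ∉ (Torus.freqBall N).erase (0 : Fin 3 → ℤ), tcoef w k = 0) :
    Torus.inertialPairing (u.1 : L2T3) w =
      ∑ k ∈ Torus.freqBall N,
        (inner ℂ (Torus.convectionCoeff (Torus.freqBall N) (coef u) (tcoef w) k) (coef u k)).re := by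
  set S : Finset (Fin 3 → ℤ) := Torus.freqBall N with hSdef
  have hS : ∀ k ∈ S, -k ∈ S := Torus.neg_mem_freqBall_of_mem
  set urep : UnitAddTorus (Fin 3) → EuclideanSpace ℝ (Fin 3) := ((u.1 : L2T3) : _ → _) with hurep
  have hmem : MemLp urep 2 volume := Lp.memLp _
  have hint : Integrable urep volume := hmem.integrable one_le_two
  have hcu : Torus.IsConjSymm (coef u) := Torus.isConjSymm_mFourierCoeff hint
  have hcw : Torus.IsConjSymm (tcoef w) := Torus.isConjSymm_mFourierCoeff hw.continuous.integrable_unitAddTorus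
  -- `P_N u = u` a.e. and `P_N w = w` everywhere
  have hu_ae : (fun x => Torus.fourierTruncate N urep x) =ᵐ[volume] urep :=
    fourierTruncate_ae_eq_of_level (u.1 : L2T3) hu
  have hw_eq : Torus.fourierTruncate N w = w :=
    Torus.fourierTruncate_eq_self hw.continuous fun k hk =>
      hwb k fun h => (Torus.not_mem_freqBall.2 hk) (Finset.mem_of_mem_erase h)
  have hPu : Torus.fourierTruncate N urep = Torus.realTrigPoly S (coef u) := rfl
  have hPw : Torus.fourierTruncate N w = Torus.realTrigPoly S (tcoef w) := rfl
  -- rewrite the pairing on trigonometric polynomials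
  have h1 : (fun x => ⟪Torus.fderiv w x (urep x), urep x⟫_ℝ) =ᵐ[volume] fun x =>
      ⟪Torus.convect (Torus.realTrigPoly S (coef u)) (Torus.realTrigPoly S (tcoef w)) x,
        Torus.realTrigPoly S (coef u) x⟫_ℝ := by
    filter_upwards [hu_ae] with x hx
    rw [← hPu, ← hPw, hw_eq, Torus.convect, hx]
  unfold Torus.inertialPairing
  rw [integral_congr_ae h1]
  have hsm : Torus.IsSmooth (Torus.convect (Torus.realTrigPoly S (coef u)) (Torus.realTrigPoly S (tcoef w))) :=
    (Torus.isSmooth_realTrigPoly _ _).convect (Torus.isSmooth_realTrigPoly _ _)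
  rw [Torus.integral_inner_realTrigPoly_right hS hcu (hsm.memLp 2)]
  refine Finset.sum_congr rfl fun k _ => ?_
  rw [Torus.mFourierCoeff_convect_realTrigPoly hS hcu hcw]

end Coefficients

/-! ## The combinatorics of the unit ball: no triads -/

section Ball

/-- Integer form of membership in the unit frequency ball. [folklore] -/
theorem sum_sq_le_one_of_mem_freqBall_one {k : Fin 3 → ℤ} (hk : k ∈ Torus.freqBall 1) :
    k 0 ^ 2 + k 1 ^ 2 + k 2 ^ 2 ≤ 1 := by
  have h := Torus.mem_freqBall.1 hk
  simp only [Torus.freqNormSq, Fin.sum_univ_three, Nat.cast_one, one_pow] at h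
  exact_mod_cast h

/-- The arithmetic core: two lattice points of the closed unit ball whose sum is a NONZERO point of
the ball — one of them is zero. [folklore] -/
theorem eq_zero_or_eq_zero_aux (a b c d e f : ℤ) (h1 : a ^ 2 + b ^ 2 + c ^ 2 ≤ 1)
    (h2 : d ^ 2 + e ^ 2 + f ^ 2 ≤ 1) (h3 : (a + d) ^ 2 + (b + e) ^ 2 + (c + f) ^ 2 ≤ 1)
    (h0 : ¬ (a + d = 0 ∧ b + e = 0 ∧ c + f = 0)) :
    (a = 0 ∧ b = 0 ∧ c = 0) ∨ (d = 0 ∧ e = 0 ∧ f = 0) := by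
  by_contra H
  push Not at H
  obtain ⟨Hl, Hm⟩ := H
  have sq1 : ∀ z : ℤ, z ≠ 0 → 1 ≤ z ^ 2 := fun z hz => (one_le_sq_iff_one_le_abs z).2 (Int.one_le_abs hz)
  have hl1 : 1 ≤ a ^ 2 + b ^ 2 + c ^ 2 := by
    by_cases ha : a = 0
    · by_cases hb : b = 0
      · have hc := Hl ha hb
        nlinarith [sq1 c hc, sq_nonneg a, sq_nonneg b]
      · nlinarith [sq1 b hb, sq_nonneg a, sq_nonneg c]
    · nlinarith [sq1 a ha, sq_nonneg b, sq_nonneg c]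
  have hm1 : 1 ≤ d ^ 2 + e ^ 2 + f ^ 2 := by
    by_cases hd : d = 0
    · by_cases he : e = 0
      · have hf := Hm hd he
        nlinarith [sq1 f hf, sq_nonneg d, sq_nonneg e]
      · nlinarith [sq1 e he, sq_nonneg d, sq_nonneg f]
    · nlinarith [sq1 d hd, sq_nonneg e, sq_nonneg f]
  set x : ℤ := a * d + b * e + c * f with hx
  have hexp : (a + d) ^ 2 + (b + e) ^ 2 + (c + f) ^ 2 =
      (a ^ 2 + b ^ 2 + c ^ 2) + (d ^ 2 + e ^ 2 + f ^ 2) + 2 * x := by rw [hx]; ring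
  have h2x : 2 * x ≤ -1 := by linarith
  have hxneg : x < 0 := by linarith
  have hxle : x ≤ -1 := by linarith [Int.lt_iff_add_one_le.1 hxneg]
  have hsum0 : (a + d) ^ 2 + (b + e) ^ 2 + (c + f) ^ 2 ≤ 0 := by linarith
  have had : (a + d) ^ 2 = 0 := by nlinarith [sq_nonneg (a + d), sq_nonneg (b + e), sq_nonneg (c + f)]
  have hbe : (b + e) ^ 2 = 0 := by nlinarith [sq_nonneg (a + d), sq_nonneg (b + e), sq_nonneg (c + f)]
  have hcf : (c + f) ^ 2 = 0 := by nlinarith [sq_nonneg (a + d), sq_nonneg (b + e), sq_nonneg (c + f)]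
  exact h0 ⟨pow_eq_zero_iff two_ne_zero |>.1 had, pow_eq_zero_iff two_ne_zero |>.1 hbe,
    pow_eq_zero_iff two_ne_zero |>.1 hcf⟩

/-- **The unit ball carries no triad**: if `l, m, l + m ∈ freqBall 1` and `l + m ≠ 0` then
`l = 0` or `m = 0`. [folklore] -/
theorem eq_zero_or_eq_zero_of_mem_freqBall_one {l m : Fin 3 → ℤ} (hl : l ∈ Torus.freqBall 1)
    (hm : m ∈ Torus.freqBall 1) (hk : l + m ∈ Torus.freqBall 1) (hk0 : l + m ≠ 0) :
    l = 0 ∨ m = 0 := by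
  have h1 := sum_sq_le_one_of_mem_freqBall_one hl
  have h2 := sum_sq_le_one_of_mem_freqBall_one hm
  have h3 := sum_sq_le_one_of_mem_freqBall_one hk
  simp only [Pi.add_apply] at h3
  have h0 : ¬ (l 0 + m 0 = 0 ∧ l 1 + m 1 = 0 ∧ l 2 + m 2 = 0) := by
    rintro ⟨e0, e1, e2⟩
    refine hk0 (funext fun i => ?_)
    fin_cases i <;> simp [e0, e1, e2]
  rcases eq_zero_or_eq_zero_aux _ _ _ _ _ _ h1 h2 h3 h0 with ⟨e0, e1, e2⟩ | ⟨e0, e1, e2⟩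
  · left; funext i; fin_cases i <;> simp [e0, e1, e2]
  · right; funext i; fin_cases i <;> simp [e0, e1, e2]

/-- **The convection symbol of the unit ball vanishes off the mean mode**: for coefficient
families supported in `(freqBall 1).erase 0`, `B̂_k(c, c') = 0` for every `k ∈ freqBall 1`,
`k ≠ 0`. [folklore] -/
theorem convectionCoeff_freqBall_one_eq_zero {c c' : (Fin 3 → ℤ) → EuclideanSpace ℂ (Fin 3)}
    (hc : ∀ k ∉ (Torus.freqBall 1).erase (0 : Fin 3 → ℤ), c k = 0)
    (hc' : ∀ k ∉ (Torus.freqBall 1).erase (0 : Fin 3 → ℤ), c' k = 0)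
    {k : Fin 3 → ℤ} (hk : k ∈ Torus.freqBall 1) (hk0 : k ≠ 0) :
    Torus.convectionCoeff (Torus.freqBall 1) c c' k = 0 := by
  rw [Torus.convectionCoeff_def]
  refine Finset.sum_eq_zero fun l hl => Finset.sum_eq_zero fun m hm => ?_
  split_ifs with hlm
  · subst hlm
    rcases eq_zero_or_eq_zero_of_mem_freqBall_one hl hm hk hk0 with rfl | rfl
    · rw [hc 0 (by simp)]
      simp
    · rw [hc' 0 (by simp)]
      simp
  · rfl

end Ball

/-! ## Level one is inert -/

section Inert

/-- Local notation for the real Hilbert space `L²(T³; ℝ³)`. -/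
local notation "L2T3" => Lp (EuclideanSpace ℝ (Fin 3)) 2 (volume : Measure (UnitAddTorus (Fin 3)))

/-- **`B_1 ≡ 0`: level one is inert.** For a level-`1` field `u ∈ H` and every smooth test field
band-limited to `(freqBall 1).erase 0`, the Euler bracket vanishes:
`⟨B(u), w⟩ = Torus.nsGeneratorPairing 0 0 u w = 0`. Every polynomial observable is therefore a
Casimir of level-`1` Galerkin–Euler. [folklore] -/
theorem nsGeneratorPairing_zero_zero_of_level_one (u : Torus.energySpace (Fin 3)) (hu : IsLevel 1 u)
    {w : UnitAddTorus (Fin 3) → EuclideanSpace ℝ (Fin 3)} (hw : Torus.IsSmooth w)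
    (hwb : ∀ k ∉ (Torus.freqBall 1).erase (0 : Fin 3 → ℤ), tcoef w k = 0) :
    Torus.nsGeneratorPairing (d := Fin 3) 0 0 u w = 0 := by
  have h0 : Torus.nsGeneratorPairing (d := Fin 3) 0 0 u w = Torus.inertialPairing (u.1 : L2T3) w := by
    unfold Torus.nsGeneratorPairing
    simp
  rw [h0, inertialPairing_eq_sum_convectionCoeff u hu hw hwb]
  refine Finset.sum_eq_zero fun k hk => ?_
  by_cases hk0 : k = 0
  · subst hk0
    rw [show coef u 0 = 0 from hu 0 (by simp)]
    simp
  · have hcu : ∀ k ∉ (Torus.freqBall 1).erase (0 : Fin 3 → ℤ), coef u k = 0 := hu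
    rw [convectionCoeff_freqBall_one_eq_zero hcu hwb hk hk0]
    simp

end Inert

/-! ## Polynomial cylindrical test fields are band tests -/

section PolyGrad

/-- `∇p(u) = Σᵢ ∂ᵢP((u,g)) gᵢ` is smooth. [folklore] -/
theorem isSmooth_polyGrad {m : ℕ} (g : Fin m → UnitAddTorus (Fin 3) → EuclideanSpace ℝ (Fin 3))
    (P : MvPolynomial (Fin m) ℝ) (u : Torus.energySpace (Fin 3)) (hg : ∀ i, Torus.IsSmooth (g i)) :
    Torus.IsSmooth (polyGrad g P u) :=
  Torus.isSmooth_sum_smul Finset.univ _ fun i _ => hg i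

/-- Fourier coefficients of `∇p(u)`: `𝓕(∇p(u))(k) = Σᵢ ∂ᵢP((u,g)) 𝓕(gᵢ)(k)`. [folklore] -/
theorem tcoef_polyGrad {m : ℕ} (g : Fin m → UnitAddTorus (Fin 3) → EuclideanSpace ℝ (Fin 3))
    (P : MvPolynomial (Fin m) ℝ) (u : Torus.energySpace (Fin 3)) (hg : ∀ i, Torus.IsSmooth (g i))
    (k : Fin 3 → ℤ) :
    tcoef (polyGrad g P u) k = ∑ i, ((MvPolynomial.eval (fun j => Torus.pairing u.1 (g j))
      (MvPolynomial.pderiv i P) : ℝ) : ℂ) • tcoef (g i) k := by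
  unfold tcoef polyGrad
  have hfun : (EuclideanSpace.complexify ∘ fun x => ∑ i, (MvPolynomial.eval
      (fun j => Torus.pairing u.1 (g j)) (MvPolynomial.pderiv i P)) • g i x) =
      fun x => ∑ i ∈ Finset.univ, ((((MvPolynomial.eval (fun j => Torus.pairing u.1 (g j))
        (MvPolynomial.pderiv i P) : ℝ) : ℂ)) • (EuclideanSpace.complexify ∘ g i)) x := by
    funext x
    simp only [Function.comp_apply, map_sum, Pi.smul_apply]
    refine Finset.sum_congr rfl fun i _ => ?_
    rw [LinearIsometry.map_smul, Complex.coe_smul]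
  rw [hfun, Torus.mFourierCoeff_finset_sum Finset.univ (fun i _ => ?_)]
  · refine Finset.sum_congr rfl fun i _ => ?_
    rw [Torus.mFourierCoeff_const_smul]
  · exact ((EuclideanSpace.continuous_complexify.comp (hg i).continuous).integrable_unitAddTorus).smul _

/-- `∇p(u)` is band-limited like the `gᵢ`. [folklore] -/
theorem tcoef_polyGrad_eq_zero {N m : ℕ} (g : Fin m → UnitAddTorus (Fin 3) → EuclideanSpace ℝ (Fin 3))
    (P : MvPolynomial (Fin m) ℝ) (u : Torus.energySpace (Fin 3)) (hg : ∀ i, IsBandTest N (g i))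
    {k : Fin 3 → ℤ} (hk : k ∉ (Torus.freqBall N).erase (0 : Fin 3 → ℤ)) :
    tcoef (polyGrad g P u) k = 0 := by
  rw [tcoef_polyGrad g P u (fun i => (hg i).1)]
  refine Finset.sum_eq_zero fun i _ => ?_
  rw [show tcoef (g i) k = 0 from (hg i).2.2.2 k hk, smul_zero]

/-- **At level one every polynomial observable is a Casimir**: the Euler bracket
`{p, B_1}(u) = ⟨B(u), ∇p(u)⟩` vanishes at every level-`1` field, for every polynomial cylindrical
observable with level-`1` band tests. [folklore] -/
theorem euler_bracket_polyGrad_eq_zero_of_level_one {m : ℕ}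
    (g : Fin m → UnitAddTorus (Fin 3) → EuclideanSpace ℝ (Fin 3)) (P : MvPolynomial (Fin m) ℝ)
    (hg : ∀ i, IsBandTest 1 (g i)) (u : Torus.energySpace (Fin 3)) (hu : IsLevel 1 u) :
    Torus.nsGeneratorPairing (d := Fin 3) 0 0 u (polyGrad g P u) = 0 :=
  nsGeneratorPairing_zero_zero_of_level_one u hu (isSmooth_polyGrad g P u fun i => (hg i).1)
    fun _ hk => tcoef_polyGrad_eq_zero g P u hg hk

end PolyGrad

/-! ## S2 (i) fails at level one: a nonzero cubic Casimir -/

section Cubic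

/-- Local notation for the real Hilbert space `L²(T³; ℝ³)`. -/
local notation "L2T3" => Lp (EuclideanSpace ℝ (Fin 3)) 2 (volume : Measure (UnitAddTorus (Fin 3)))

/-- The Kolmogorov field `K_a = a cos(2πx₁)e₀` is band-limited to `(freqBall 1).erase 0`. [folklore] -/
theorem tcoef_kolField_eq_zero (a : ℝ) {k : Fin 3 → ℤ}
    (hk : k ∉ (Torus.freqBall 1).erase (0 : Fin 3 → ℤ)) : tcoef (kolField a) k = 0 := by
  have h := isLevel_kolState a le_rfl k hk
  rwa [mFourierCoeff_congr_ae (coe_kolState_ae a)] at h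

/-- `K_a` is a level-`1` band test. [folklore] -/
theorem isBandTest_kolField (a : ℝ) : IsBandTest 1 (kolField a) :=
  ⟨isSmooth_kolField a, isDivFree_kolField a, hasZeroMean_kolField a, fun _ hk => tcoef_kolField_eq_zero a hk⟩

/-- `([K_a], K_a) = a²/2`. [folklore] -/
theorem pairing_kolState_kolField (a : ℝ) :
    Torus.pairing ((kolState a).1 : L2T3) (kolField a) = a ^ 2 / 2 := by
  unfold Torus.pairing
  rw [← integral_norm_sq_kolField a]
  refine integral_congr_ae ((coe_kolState_ae a).mono fun x hx => ?_)
  simp only at hx ⊢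
  rw [hx, real_inner_self_eq_norm_sq]

/-- **`¬ NoCubicCasimir 1`**: the cubic observable `(u, K_1)³` is a Casimir of level-`1`
Galerkin–Euler (everything is) but does not vanish at `u = [K_1]` (value `(1/2)³`). The
"`∀ N ≥ 1`" strengthening of conjunct (i) of `stub_casimirs` is false; S2 lives at `N ≥ 2`. [folklore] -/
theorem not_noCubicCasimir_one : ¬ NoCubicCasimir 1 := by
  intro h
  have h1 := h 1 (fun _ => kolField 1) (MvPolynomial.X 0 ^ 3) (fun _ => isBandTest_kolField 1)
    ((MvPolynomial.isHomogeneous_X ℝ (0 : Fin 1)).pow 3)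
    (fun u hu => euler_bracket_polyGrad_eq_zero_of_level_one _ _ (fun _ => isBandTest_kolField 1) u hu)
    (kolState 1) (isLevel_kolState 1 le_rfl)
  rw [map_pow, MvPolynomial.eval_X, pairing_kolState_kolField] at h1
  norm_num at h1

end Cubic

/-! ## A second laminar family `K'_a = a cos(2πx₂) e₀` (frequency `e₂`, polarisation `e₀`) -/

section LaminarTwo

/-- Local notation for the real Hilbert space `L²(T³; ℝ³)`. -/
local notation "L2T3" => Lp (EuclideanSpace ℝ (Fin 3)) 2 (volume : Measure (UnitAddTorus (Fin 3)))

/-- The frequency `e₂ = (0,0,1)`. -/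
def kolFreq₂ : Fin 3 → ℤ := Pi.single 2 1

/-- The symmetric frequency pair `{e₂, −e₂}`. -/
def kolSet₂ : Finset (Fin 3 → ℤ) := {kolFreq₂, -kolFreq₂}

/-- The second laminar field `K'_a(x) = a cos(2πx₂) e₀`. -/
def kolField₂ (a : ℝ) : UnitAddTorus (Fin 3) → EuclideanSpace ℝ (Fin 3) :=
  Torus.realTrigPoly kolSet₂ (kolCoeff a)

/-- Bookkeeping for the second laminar family. [folklore] -/
theorem kolFreq₂_ne_zero : kolFreq₂ ≠ 0 := fun h => by
  have := congrFun h 2; simp [kolFreq₂] at this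

/-- Bookkeeping for the second laminar family. [folklore] -/
theorem freqNormSq_kolFreq₂ : Torus.freqNormSq kolFreq₂ = 1 := by
  simp [Torus.freqNormSq, kolFreq₂, Fin.sum_univ_three]

/-- Bookkeeping for the second laminar family. [folklore] -/
theorem neg_mem_kolSet₂ : ∀ k ∈ kolSet₂, -k ∈ kolSet₂ := by
  intro k hk
  simp only [kolSet₂, Finset.mem_insert, Finset.mem_singleton] at hk ⊢
  rcases hk with rfl | rfl <;> simp

/-- Bookkeeping for the second laminar family. [folklore] -/
theorem freqNormSq_of_mem_kolSet₂ {k : Fin 3 → ℤ} (hk : k ∈ kolSet₂) : Torus.freqNormSq k = 1 := by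
  simp only [kolSet₂, Finset.mem_insert, Finset.mem_singleton] at hk
  rcases hk with rfl | rfl
  · exact freqNormSq_kolFreq₂
  · rw [Torus.freqNormSq_neg]; exact freqNormSq_kolFreq₂

/-- Bookkeeping for the second laminar family. [folklore] -/
theorem ne_zero_of_mem_kolSet₂ {k : Fin 3 → ℤ} (hk : k ∈ kolSet₂) : k ≠ 0 := by
  intro h; subst h
  have := freqNormSq_of_mem_kolSet₂ hk
  rw [Torus.freqNormSq_zero] at this
  exact zero_ne_one this

/-- Bookkeeping for the second laminar family. [folklore] -/
theorem apply_zero_of_mem_kolSet₂ {k : Fin 3 → ℤ} (hk : k ∈ kolSet₂) : k 0 = 0 := by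
  simp only [kolSet₂, Finset.mem_insert, Finset.mem_singleton] at hk
  rcases hk with rfl | rfl <;> simp [kolFreq₂]

/-- Bookkeeping for the second laminar family. [folklore] -/
theorem isTransversal_kolCoeff₂ (a : ℝ) : Torus.IsTransversal kolSet₂ (kolCoeff a) := by
  intro k hk
  simp [kolCoeff, EuclideanSpace.complexify_apply, Fin.sum_univ_three, apply_zero_of_mem_kolSet₂ hk]

/-- `K'_a` is smooth. [folklore] -/
theorem isSmooth_kolField₂ (a : ℝ) : Torus.IsSmooth (kolField₂ a) :=
  Torus.isSmooth_realTrigPoly _ _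

/-- `K'_a` is divergence free. [folklore] -/
theorem isDivFree_kolField₂ (a : ℝ) : Torus.IsDivFree (kolField₂ a) :=
  Torus.isDivFree_realTrigPoly (isTransversal_kolCoeff₂ a)

/-- `K'_a` has zero mean. [folklore] -/
theorem hasZeroMean_kolField₂ (a : ℝ) : Torus.HasZeroMean (kolField₂ a) := by
  unfold Torus.HasZeroMean kolField₂
  simp_rw [Torus.realTrigPoly_apply_eq_sum]
  rw [integral_finsetSum _ fun k _ => ?_]
  · refine Finset.sum_eq_zero fun k hk => ?_
    have hi : Integrable (fun x : UnitAddTorus (Fin 3) => UnitAddTorus.mFourier k x • kolCoeff a k) volume :=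
      ((UnitAddTorus.mFourier k).continuous.smul continuous_const).integrable_unitAddTorus
    rw [ContinuousLinearMap.integral_comp_comm _ hi, integral_smul_const, Torus.integral_mFourier,
      if_neg (ne_zero_of_mem_kolSet₂ hk), zero_smul, map_zero]
  · exact (EuclideanSpace.realPart.continuous.comp
      ((UnitAddTorus.mFourier k).continuous.smul continuous_const)).integrable_unitAddTorus

/-- Bookkeeping for the second laminar family. [folklore] -/
theorem kolFreq₂_ne_neg : kolFreq₂ ≠ -kolFreq₂ := fun h => by
  have := congrFun h 2; simp [kolFreq₂] at this

/-- Bookkeeping for the second laminar family. [folklore] -/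
theorem card_kolSet₂ : kolSet₂.card = 2 := by
  rw [kolSet₂, Finset.card_insert_of_notMem (by simpa using kolFreq₂_ne_neg), Finset.card_singleton]

/-- `∫ ‖K'_a‖² = a²/2`. [folklore] -/
theorem integral_norm_sq_kolField₂ (a : ℝ) : ∫ x, ‖kolField₂ a x‖ ^ 2 = a ^ 2 / 2 := by
  rw [kolField₂, Torus.integral_norm_sq_realTrigPoly neg_mem_kolSet₂ (isConjSymm_kolCoeff a),
    Finset.sum_congr rfl fun k _ => by rw [norm_kolCoeff], Finset.sum_const, card_kolSet₂]
  simp only [nsmul_eq_mul, Nat.cast_ofNat, div_pow, sq_abs]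
  ring

/-- The class of `K'_a` in `H`. -/
def kolState₂ (a : ℝ) : Torus.energySpace (Fin 3) :=
  ⟨((isSmooth_kolField₂ a).memLp 2).toLp (kolField₂ a),
    Torus.smoothSolenoidal_subset_energySpace ⟨kolField₂ a, isSmooth_kolField₂ a,
      isDivFree_kolField₂ a, hasZeroMean_kolField₂ a, MemLp.coeFn_toLp _⟩⟩

/-- Bookkeeping for the second laminar family. [folklore] -/
theorem coe_kolState₂_ae (a : ℝ) :
    (((kolState₂ a).1 : L2T3) : UnitAddTorus (Fin 3) → EuclideanSpace ℝ (Fin 3)) =ᵐ[volume] kolField₂ a :=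
  MemLp.coeFn_toLp ((isSmooth_kolField₂ a).memLp 2)

/-- `K'_a` is a level-`1` field. [folklore] -/
theorem isLevel_kolState₂ (a : ℝ) {N : ℕ} (hN : 1 ≤ N) : IsLevel N (kolState₂ a) := by
  intro k hk
  rw [mFourierCoeff_congr_ae (coe_kolState₂_ae a), kolField₂]
  have hk' : k ∉ kolSet₂ := fun hkS => hk (Finset.mem_erase.2 ⟨ne_zero_of_mem_kolSet₂ hkS,
    Torus.mem_freqBall.2 (by
      rw [freqNormSq_of_mem_kolSet₂ hkS]
      have : (1 : ℝ) ≤ N := by exact_mod_cast hN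
      nlinarith)⟩)
  have hnk' : -k ∉ kolSet₂ := fun h => hk' (by simpa using neg_mem_kolSet₂ _ h)
  exact Torus.mFourierCoeff_realTrigPoly_eq_zero_of_not_mem _ hk' hnk'

/-- The two laminar families are `L²`-orthogonal: `([K'_a], K_b) = 0` (disjoint frequency supports). [folklore] -/
theorem pairing_kolState₂_kolField (a b : ℝ) :
    Torus.pairing ((kolState₂ a).1 : L2T3) (kolField b) = 0 := by
  unfold Torus.pairing
  rw [integral_congr_ae ((coe_kolState₂_ae a).mono fun x hx =>
    show ⟪(((kolState₂ a).1 : L2T3) : UnitAddTorus (Fin 3) → EuclideanSpace ℝ (Fin 3)) x, kolField b x⟫_ℝ =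
      ⟪kolField₂ a x, kolField b x⟫_ℝ by rw [hx])]
  rw [kolField₂, Torus.integral_inner_realTrigPoly_left neg_mem_kolSet₂ (isConjSymm_kolCoeff a)
    ((isSmooth_kolField b).memLp 2)]
  refine Finset.sum_eq_zero fun k hk => ?_
  have h1 : k ∉ kolSet := by
    simp only [kolSet₂, Finset.mem_insert, Finset.mem_singleton] at hk
    simp only [kolSet, Finset.mem_insert, Finset.mem_singleton, not_or]
    rcases hk with rfl | rfl <;>
      exact ⟨fun h => by have := congrFun h 2; simp [kolFreq, kolFreq₂] at this,
        fun h => by have := congrFun h 2; simp [kolFreq, kolFreq₂] at this⟩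
  have h2 : -k ∉ kolSet := fun h => h1 (by simpa using neg_mem_kolSet _ h)
  rw [kolField, Torus.mFourierCoeff_realTrigPoly_eq_zero_of_not_mem _ h1 h2, inner_zero_right,
    Complex.zero_re]

end LaminarTwo

/-! ## S2 (ii) fails at level one: a quadratic Casimir that is not `αE + βH` -/

section Quad

/-- Local notation for the real Hilbert space `L²(T³; ℝ³)`. -/
local notation "L2T3" => Lp (EuclideanSpace ℝ (Fin 3)) 2 (volume : Measure (UnitAddTorus (Fin 3)))

/-- The differential of the quadratic observable `(u, K)²`: `∇p(u) = 2(u,K) K`. [folklore] -/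
theorem polyGrad_X_sq (K : UnitAddTorus (Fin 3) → EuclideanSpace ℝ (Fin 3))
    (u : Torus.energySpace (Fin 3)) (x : UnitAddTorus (Fin 3)) :
    polyGrad (fun _ : Fin 1 => K) (MvPolynomial.X 0 ^ 2) u x = (2 * Torus.pairing u.1 K) • K x := by
  simp [polyGrad, Derivation.leibniz_pow, MvPolynomial.pderiv_X]

/-- The truncation of a state's representative is the field: `P_N [F] = F` for a smooth field `F`
band-limited to the ball and a.e. equal to the representative. [folklore] -/
theorem fourierTruncate_coe_eq {N : ℕ} {u : Torus.energySpace (Fin 3)}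
    {F : UnitAddTorus (Fin 3) → EuclideanSpace ℝ (Fin 3)} (hF : Torus.IsSmooth F)
    (hae : ((u.1 : L2T3) : UnitAddTorus (Fin 3) → EuclideanSpace ℝ (Fin 3)) =ᵐ[volume] F)
    (hu : IsLevel N u) :
    Torus.fourierTruncate N ((u.1 : L2T3) : UnitAddTorus (Fin 3) → EuclideanSpace ℝ (Fin 3)) = F := by
  have hcoe : (fun k => UnitAddTorus.mFourierCoeff (EuclideanSpace.complexify ∘
      ((u.1 : L2T3) : UnitAddTorus (Fin 3) → EuclideanSpace ℝ (Fin 3))) k) = fun k => tcoef F k :=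
    funext fun k => mFourierCoeff_congr_ae hae k
  rw [Torus.fourierTruncate_eq, hcoe]
  change Torus.fourierTruncate N F = F
  refine Torus.fourierTruncate_eq_self hF.continuous fun k hk => ?_
  have h := hu k (fun h => (Torus.not_mem_freqBall.2 hk) (Finset.mem_of_mem_erase h))
  rwa [mFourierCoeff_congr_ae hae] at h

/-- The components `i ≠ 0` of `realTrigPoly S (kolCoeff a)` vanish (polarisation `e₀`). [folklore] -/
theorem realTrigPoly_kolCoeff_apply_of_ne (S : Finset (Fin 3 → ℤ)) (a : ℝ) (x : UnitAddTorus (Fin 3))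
    {i : Fin 3} (hi : i ≠ 0) : Torus.realTrigPoly S (kolCoeff a) x i = 0 := by
  rw [Torus.realTrigPoly_apply_coord, Torus.trigPoly_apply]
  simp [kolCoeff, EuclideanSpace.complexify_apply, hi.symm]

/-- The components `i ≠ 0` of every partial derivative of `realTrigPoly S (kolCoeff a)` vanish. [folklore] -/
theorem partialDeriv_realTrigPoly_kolCoeff_apply_of_ne (S : Finset (Fin 3 → ℤ)) (a : ℝ) (j : Fin 3)
    (x : UnitAddTorus (Fin 3)) {i : Fin 3} (hi : i ≠ 0) :
    Torus.partialDeriv j (Torus.realTrigPoly S (kolCoeff a)) x i = 0 := by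
  rw [Torus.partialDeriv_realTrigPoly, Torus.realTrigPoly_apply_coord, Torus.trigPoly_apply]
  simp [kolCoeff, EuclideanSpace.complexify_apply, hi.symm]

/-- The `e₀`-polarised laminar fields are pointwise orthogonal to their curl:
`⟪F(x), curl F(x)⟫ = 0` for `F = realTrigPoly S (kolCoeff a)`. [folklore] -/
theorem inner_curl_realTrigPoly_kolCoeff (S : Finset (Fin 3 → ℤ)) (a : ℝ) (x : UnitAddTorus (Fin 3)) :
    ⟪Torus.realTrigPoly S (kolCoeff a) x, BDSV.curl (Torus.realTrigPoly S (kolCoeff a)) x⟫_ℝ = 0 := by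
  obtain ⟨h0, -, -⟩ := IntermittentBeltrami.curl_apply_fin (Torus.realTrigPoly S (kolCoeff a)) x
  have hc0 : BDSV.curl (Torus.realTrigPoly S (kolCoeff a)) x 0 = 0 := by
    rw [h0, partialDeriv_realTrigPoly_kolCoeff_apply_of_ne S a 1 x (by decide),
      partialDeriv_realTrigPoly_kolCoeff_apply_of_ne S a 2 x (by decide), sub_zero]
  simp [PiLp.inner_apply, Fin.sum_univ_three, hc0,
    realTrigPoly_kolCoeff_apply_of_ne S a x (i := 1) (by decide),
    realTrigPoly_kolCoeff_apply_of_ne S a x (i := 2) (by decide)]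

/-- A field with `∫‖F‖² ≠ 0` is nonzero somewhere. [folklore] -/
theorem exists_ne_zero_of_integral_norm_sq_ne_zero {F : UnitAddTorus (Fin 3) → EuclideanSpace ℝ (Fin 3)}
    (h : ∫ x, ‖F x‖ ^ 2 ≠ 0) : ∃ x, F x ≠ 0 := by
  by_contra hF
  push Not at hF
  exact h (by simp [hF])

/-- **`¬ QuadRigidity 1`**: the quadratic Casimir `(u, K_1)²` of level-`1` Galerkin–Euler
(everything is a Casimir there) has gradient `2(u,K_1)K_1`, which is not of the form
`2α P_1 u + 2β curl P_1 u`: at `u = [K_1]` pointwise orthogonality `K ⊥ curl K` forces `α = 1/2`,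
and then at the orthogonal level-`1` state `u = [K'_1]` (`K' = cos(2πx₂)e₀`) the identity reads
`0 = K' + 2β curl K'`, impossible as `K' ⊥ curl K'` pointwise and `K' ≢ 0`. The "`∀ N ≥ 1`"
strengthening of conjunct (ii) of `stub_casimirs` is false. [folklore] -/
theorem not_quadRigidity_one : ¬ QuadRigidity 1 := by
  intro h
  obtain ⟨α, β, hαβ⟩ := h 1 (fun _ => kolField 1) (MvPolynomial.X 0 ^ 2)
    (fun _ => isBandTest_kolField 1) ((MvPolynomial.isHomogeneous_X ℝ (0 : Fin 1)).pow 2)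
    (fun u hu => euler_bracket_polyGrad_eq_zero_of_level_one _ _ (fun _ => isBandTest_kolField 1) u hu)
  have h0 := hαβ (kolState 1) (isLevel_kolState 1 le_rfl)
  have h1 := hαβ (kolState₂ 1) (isLevel_kolState₂ 1 le_rfl)
  simp only [polyGrad_X_sq, pairing_kolState_kolField, pairing_kolState₂_kolField,
    fourierTruncate_coe_eq (isSmooth_kolField 1) (coe_kolState_ae 1) (isLevel_kolState 1 le_rfl),
    fourierTruncate_coe_eq (isSmooth_kolField₂ 1) (coe_kolState₂_ae 1) (isLevel_kolState₂ 1 le_rfl)]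
    at h0 h1
  -- Step 1: `α = 1/2` from `u = [K_1]`, pairing the identity with `K_1(x₀)` where `K_1(x₀) ≠ 0`
  obtain ⟨x₀, hx₀⟩ := exists_ne_zero_of_integral_norm_sq_ne_zero (F := kolField 1)
    (by rw [integral_norm_sq_kolField]; norm_num)
  have hα : α = 1 / 2 := by
    have e := congrArg (fun v => ⟪kolField 1 x₀, v⟫_ℝ) (h0 x₀)
    simp only [inner_add_right, inner_smul_right, real_inner_self_eq_norm_sq] at e
    rw [kolField, inner_curl_realTrigPoly_kolCoeff, ← kolField] at e
    have hn : ‖kolField 1 x₀‖ ^ 2 ≠ 0 := by positivity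
    have e' : (1 - 2 * α) * ‖kolField 1 x₀‖ ^ 2 = 0 := by nlinarith [e]
    rcases mul_eq_zero.1 e' with h' | h'
    · linarith
    · exact absurd h' hn
  -- Step 2: at `u = [K'_1]` the identity forces `K'_1 ≡ 0`
  obtain ⟨x₁, hx₁⟩ := exists_ne_zero_of_integral_norm_sq_ne_zero (F := kolField₂ 1)
    (by rw [integral_norm_sq_kolField₂]; norm_num)
  have e := congrArg (fun v => ⟪kolField₂ 1 x₁, v⟫_ℝ) (h1 x₁)
  simp only [inner_add_right, inner_smul_right, real_inner_self_eq_norm_sq] at e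
  rw [kolField₂, inner_curl_realTrigPoly_kolCoeff, ← kolField₂, hα] at e
  have hn : ‖kolField₂ 1 x₁‖ ^ 2 ≠ 0 := by positivity
  apply hn
  nlinarith [e]

end Quad


/-! ## I. (cycle 2) THE HONEST ORDER-4 GATE — what the planner should read from the adversary

The crux as typed asks only `Integrable ‖u‖⁴`; the line `recession-cone` exploits exactly this (far
antipodal atoms at distance `R → ∞`, weight `∝ R⁻⁴`, absorb every cubic-row defect). The rung of the
route TARGET it is meant to gate (`MomentLadder`, `d = 4`) carries a SUPPORT BOUND `‖u‖ ≤ R` with `R`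
chosen per `j` BEFORE the frequently-many `N` (and a resolved-dissipation schedule). The statement below,
`QuarticGateSupported`, is that rung minus the schedule: it implies the typed crux (trivially, proved here)
and is implied by `MomentLadder` (both proved here); it is NOT EVIDENTLY reached by the line (the surgery
radii of S5/S4 are chosen after `N`; they stay `N`-uniform only if the total weight `Σcᵢ` of the S3 defect
certificate — a conic gauge in a space of dimension `≍ N⁹` — stays bounded along the levels, which nothing
in the line controls), and it is the statement on which the card's physics ("PSD at order 4 may
force Taylor-scale flatness `≳ Re_λ^γ`") actually bears. The standing adversary could not refute it either
(no quietness certificate at SOS degree 4 is known; see header) — recorded as the recommended repair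
`C′` should the typed crux close "for the wrong reason". -/

section Honest

/-- **`C′` = `QuarticGateSupported`**: the typed crux with a support bound `‖u‖ ≤ R`, `R = R(j)` fixed
before the frequently-many levels `N` (the `d = 4` rung of `MomentLadder` without the dissipation
schedule). -/
def QuarticGateSupported : Prop :=
  ∃ f : UnitAddTorus (Fin 3) → EuclideanSpace ℝ (Fin 3),
    Torus.IsSmooth f ∧ Torus.IsDivFree f ∧ Torus.HasZeroMean f ∧
    ∃ (ν : ℕ → ℝ) (E ε : ℝ), (∀ j, 0 < ν j) ∧ Tendsto ν atTop (𝓝 0) ∧ 0 < ε ∧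
    ∀ j : ℕ, ∃ R : ℝ, ∃ᶠ N in atTop, ∃ μ : Measure (Torus.energySpace (Fin 3)),
      IsProbabilityMeasure μ ∧ (∀ᵐ u ∂μ, IsLevel N u) ∧ (∀ᵐ u ∂μ, ‖u‖ ≤ R) ∧
      IsPolyStationary (ν j) f N 4 μ ∧ Torus.ensembleEnergy μ ≤ E ∧ ε ≤ Torus.ensembleDissipation (ν j) μ

/-- A law supported in `‖u‖ ≤ R` has finite fourth moments. [folklore] -/
theorem integrable_norm_pow_four_of_bound {μ : Measure (Torus.energySpace (Fin 3))} [IsFiniteMeasure μ]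
    {R : ℝ} (h : ∀ᵐ u ∂μ, ‖u‖ ≤ R) :
    Integrable (fun u : Torus.energySpace (Fin 3) => ‖u‖ ^ 4) μ := by
  refine Integrable.of_bound (continuous_norm.pow 4).aestronglyMeasurable (max R 0 ^ 4) (h.mono fun u hu => ?_)
  rw [Real.norm_eq_abs, abs_of_nonneg (by positivity)]
  exact pow_le_pow_left₀ (norm_nonneg _) (hu.trans (le_max_left _ _)) 4

/-- **`QuarticGateSupported → QuarticGate`** (the honest gate implies the typed one). [folklore] -/
theorem quarticGate_of_supported (h : QuarticGateSupported) : QuarticGate := by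
  obtain ⟨f, hfs, hfd, hfz, ν, E, ε, hν, hν0, hε, hj⟩ := h
  refine quarticGate_iff.2 ⟨f, hfs, hfd, hfz, ν, E, ε, hν, hν0, hε, fun j => ?_⟩
  obtain ⟨R, hR⟩ := hj j
  refine hR.mono ?_
  rintro N ⟨μ, hp, hl, hb, hst, hE, hD⟩
  exact ⟨μ, hp, hl, integrable_norm_pow_four_of_bound hb, hst, hE, hD⟩

/-- **`MomentLadder → QuarticGateSupported`**: the honest gate IS a rung of the route target (its `d = 4`
instance, dropping the resolved-dissipation schedule). So `C′` sits between the target and the typed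
crux: `MomentLadder → QuarticGateSupported → QuarticGate`. [folklore] -/
theorem quarticGateSupported_of_momentLadder (h : MomentLadder) : QuarticGateSupported := by
  obtain ⟨f, hfs, hfd, hfz, ν, E, ε, hν, hν0, hε, hj⟩ := h
  refine ⟨f, hfs, hfd, hfz, ν, E, ε, hν, hν0, hε, fun j => ?_⟩
  obtain ⟨R, κ, hR⟩ := hj j
  refine ⟨R, hR.mono fun N hN => ?_⟩
  obtain ⟨μ, hp, hl, hb, -, hst, hE, hD⟩ := hN 4
  exact ⟨μ, hp, hl, hb, fun m g P hg hP => hst m g P hg hP, hE, hD⟩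

end Honest


/-! ## J. (cycle 2) THE MOMENTUM ROW: an energy FLOOR from the single linear test `g = f`

Complement to the force floor (C) (`ε ≤ ‖f‖₂√E`, from the quadratic energy test): the LINEAR test `g = f`
(admissible whenever the force is itself band-limited at the level, as every trigonometric-polynomial
force of the designs is) has row `‖f‖₂² + ν(u, Δf) + ∫(u⊗u):∇f`, so every law whose linear rows vanish
obeys `‖f‖₂² ≤ ν‖Δf‖₂ √E + C_f E` with `C_f = sup_x Σᵢ‖∂ᵢf(x)‖`: STATIONARY ENSEMBLES UNDER AN `O(1)`
FORCE CARRY `O(1)` ENERGY, whatever their dissipation (`E ≥ (‖f‖₂² − ν‖Δf‖₂√E)/C_f`). With (C):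
`ε ≤ ‖f‖₂√E ≤ (ν‖Δf‖₂√E + C_f E)^{1/2} √E`, i.e. asymptotically `ε ≲ √C_f · E` — a large-scale TURNOVER
CEILING `ε ≲ U²/T_f` (`T_f = C_f^{-1/2}` the forcing shear time) on top of the injection ceiling
`ε ≤ ‖f‖U`. For the S6 force `sin(2πy)e₁`: `C_f = 2π`, so `E ≥ 1/(4π) − o(1)` and `ε ≤ (2π)^{1/2}E + o(1)`;
the design (`E = 2`, `ε = 1/4`) honours both. -/

section MomentumRow

/-- Local notation for the real Hilbert space `L²(T³; ℝ³)`. -/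
local notation "L2T3" => Lp (EuclideanSpace ℝ (Fin 3)) 2 (volume : Measure (UnitAddTorus (Fin 3)))

/-- **The momentum row bounds the energy from below.** If the row of the single linear test `g = f`
vanishes, `∫ ⟨F(u), f⟩ dμ = 0`, for a probability law with finite mean energy, then
`‖f‖₂² ≤ ν ‖Δf‖₂ (ensembleEnergy μ)^{1/2} + C · ensembleEnergy μ` for every bound
`Σᵢ ‖∂ᵢ f(x)‖ ≤ C`. (No level or band hypothesis is needed for this implication itself.) [folklore] -/
theorem force_sq_le_of_momentumRow {ν : ℝ} (hν : 0 ≤ ν)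
    {f : UnitAddTorus (Fin 3) → EuclideanSpace ℝ (Fin 3)} (hfs : Torus.IsSmooth f)
    {C : ℝ} (hC : ∀ x, ∑ i, ‖Torus.partialDeriv i f x‖ ≤ C)
    {μ : Measure (Torus.energySpace (Fin 3))} [IsProbabilityMeasure μ]
    (h2 : Integrable (fun u : Torus.energySpace (Fin 3) => ‖u‖ ^ 2) μ)
    (hrow : ∫ u, Torus.nsGeneratorPairing ν f u f ∂μ = 0) :
    ∫ x, ‖f x‖ ^ 2 ≤ ν * Real.sqrt (∫ x, ‖Torus.laplacian f x‖ ^ 2) * Real.sqrt (Torus.ensembleEnergy μ) +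
      C * Torus.ensembleEnergy μ := by
  have hΔ : MemLp (Torus.laplacian f) 2 volume := hfs.laplacian.memLp 2
  have hnorm : Integrable (fun u : Torus.energySpace (Fin 3) => ‖u‖) μ :=
    ((memLp_two_iff_integrable_sq continuous_norm.aestronglyMeasurable).2 h2).integrable one_le_two
  -- the three summands of the row, as functions of `u`
  have hff : ∀ u : Torus.energySpace (Fin 3),
      Torus.nsGeneratorPairing ν f u f = (∫ x, ‖f x‖ ^ 2) +
        ν * Torus.pairing (u.1 : L2T3) (Torus.laplacian f) + Torus.inertialPairing (u.1 : L2T3) f := by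
    intro u
    unfold Torus.nsGeneratorPairing Torus.pairing
    congr 2
    refine integral_congr_ae (ae_of_all _ fun x => ?_)
    exact real_inner_self_eq_norm_sq (f x)
  -- integrability and bounds of the two `u`-dependent summands
  have hpair_int : Integrable (fun u : Torus.energySpace (Fin 3) =>
      Torus.pairing (u.1 : L2T3) (Torus.laplacian f)) μ := by
    refine Integrable.mono' (hnorm.mul_const ‖hΔ.toLp (Torus.laplacian f)‖)
      (Torus.continuous_pairing_coe hΔ).aestronglyMeasurable (ae_of_all _ fun u => ?_)
    rw [Real.norm_eq_abs]
    exact Torus.abs_pairing_coe_le hΔ u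
  have hin_bound : ∀ u : Torus.energySpace (Fin 3), |Torus.inertialPairing (u.1 : L2T3) f| ≤ C * ‖u‖ ^ 2 := by
    intro u
    have h := (Torus.integrable_inner_fderiv_apply_coe hfs hC (u.1 : L2T3) (u.1 : L2T3)).2
    have hn : ‖(u.1 : L2T3)‖ = ‖u‖ := rfl
    rw [hn, ← sq] at h
    exact h
  have hin_int : Integrable (fun u : Torus.energySpace (Fin 3) => Torus.inertialPairing (u.1 : L2T3) f) μ := by
    refine Integrable.mono' (h2.const_mul C) (Torus.continuous_inertialPairing_coe hfs).aestronglyMeasurable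
      (ae_of_all _ fun u => ?_)
    rw [Real.norm_eq_abs]
    exact hin_bound u
  -- integrate the row
  have hi0 : Integrable (fun _ : Torus.energySpace (Fin 3) => ∫ x, ‖f x‖ ^ 2) μ := integrable_const _
  have hi1 : Integrable (fun u : Torus.energySpace (Fin 3) =>
      ν * Torus.pairing (u.1 : L2T3) (Torus.laplacian f)) μ := hpair_int.const_mul ν
  have hi01 : Integrable (fun u : Torus.energySpace (Fin 3) =>
      (∫ x, ‖f x‖ ^ 2) + ν * Torus.pairing (u.1 : L2T3) (Torus.laplacian f)) μ := hi0.add hi1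
  have hsplit : ∫ u, Torus.nsGeneratorPairing ν f u f ∂μ = (∫ x, ‖f x‖ ^ 2) +
      ν * ∫ u, Torus.pairing (u.1 : L2T3) (Torus.laplacian f) ∂μ +
        ∫ u, Torus.inertialPairing (u.1 : L2T3) f ∂μ := by
    simp_rw [hff]
    rw [integral_add hi01 hin_int, integral_add hi0 hi1, integral_const_mul, integral_const]
    simp
  rw [hrow] at hsplit
  -- bounds
  have hE0 : 0 ≤ Torus.ensembleEnergy μ := integral_nonneg fun u => by positivity
  have hCS : ∫ u : Torus.energySpace (Fin 3), ‖u‖ ∂μ ≤ Real.sqrt (Torus.ensembleEnergy μ) :=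
    Torus.integral_le_sqrt_integral_sq (ae_of_all _ fun u => norm_nonneg u)
      continuous_norm.aestronglyMeasurable h2
  have hb1 : |∫ u, Torus.pairing (u.1 : L2T3) (Torus.laplacian f) ∂μ| ≤
      Real.sqrt (∫ x, ‖Torus.laplacian f x‖ ^ 2) * Real.sqrt (Torus.ensembleEnergy μ) := by
    calc |∫ u, Torus.pairing (u.1 : L2T3) (Torus.laplacian f) ∂μ|
        ≤ ∫ u, |Torus.pairing (u.1 : L2T3) (Torus.laplacian f)| ∂μ := abs_integral_le_integral_abs
      _ ≤ ∫ u : Torus.energySpace (Fin 3), ‖u‖ * ‖hΔ.toLp (Torus.laplacian f)‖ ∂μ :=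
          integral_mono hpair_int.abs (hnorm.mul_const _) fun u => Torus.abs_pairing_coe_le hΔ u
      _ = ‖hΔ.toLp (Torus.laplacian f)‖ * ∫ u : Torus.energySpace (Fin 3), ‖u‖ ∂μ := by
          rw [integral_mul_const, mul_comm]
      _ ≤ ‖hΔ.toLp (Torus.laplacian f)‖ * Real.sqrt (Torus.ensembleEnergy μ) :=
          mul_le_mul_of_nonneg_left hCS (norm_nonneg _)
      _ = Real.sqrt (∫ x, ‖Torus.laplacian f x‖ ^ 2) * Real.sqrt (Torus.ensembleEnergy μ) := by
          rw [Torus.norm_toLp_eq_sqrt hΔ]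
  have hb2 : |∫ u, Torus.inertialPairing (u.1 : L2T3) f ∂μ| ≤ C * Torus.ensembleEnergy μ := by
    calc |∫ u, Torus.inertialPairing (u.1 : L2T3) f ∂μ|
        ≤ ∫ u, |Torus.inertialPairing (u.1 : L2T3) f| ∂μ := abs_integral_le_integral_abs
      _ ≤ ∫ u : Torus.energySpace (Fin 3), C * ‖u‖ ^ 2 ∂μ := integral_mono hin_int.abs (h2.const_mul C) hin_bound
      _ = C * Torus.ensembleEnergy μ := by rw [integral_const_mul]; rfl
  have e1 := mul_le_mul_of_nonneg_left (abs_le.1 hb1).1 hν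
  have e2 := (abs_le.1 hb2).1
  linarith [e1, e2, hsplit]

/-- The linear test `g = f` in the crux's format: for `m = 1`, `g₀ = f`, `P = X₀`, `∇p(u) = f`. [folklore] -/
theorem polyGrad_X (f : UnitAddTorus (Fin 3) → EuclideanSpace ℝ (Fin 3)) (u : Torus.energySpace (Fin 3)) :
    polyGrad (fun _ : Fin 1 => f) (MvPolynomial.X 0) u = f := by
  funext x
  simp [polyGrad, MvPolynomial.pderiv_X]

/-- **Energy floor for witnesses with a band-limited force**: if the witness force `f` is itself a
level-`N` band test (e.g. a trigonometric polynomial force at levels `N ≥ N_f`), every polynomially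
`d`-stationary (`d ≥ 2`) level-`N` law with finite mean energy obeys
`‖f‖₂² ≤ ν‖Δf‖₂ √(ensembleEnergy μ) + C_f · ensembleEnergy μ`. In `QuarticGate` (`energy ≤ E`,
`ν = ν_j → 0`): `E ≥ (‖f‖₂² − ν_j‖Δf‖₂√E)/C_f`, and with (C), `ε ≤ ‖f‖₂√E ≤ ((ν_j‖Δf‖₂√E + C_f E) E)^{1/2}`.
[folklore] -/
theorem force_sq_le_of_polyStationary {ν : ℝ} (hν : 0 ≤ ν)
    {f : UnitAddTorus (Fin 3) → EuclideanSpace ℝ (Fin 3)} {N : ℕ} (hfb : IsBandTest N f)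
    {C : ℝ} (hC : ∀ x, ∑ i, ‖Torus.partialDeriv i f x‖ ≤ C)
    {μ : Measure (Torus.energySpace (Fin 3))} [IsProbabilityMeasure μ]
    (h2 : Integrable (fun u : Torus.energySpace (Fin 3) => ‖u‖ ^ 2) μ) {d : ℕ} (hd : 2 ≤ d)
    (hstat : IsPolyStationary ν f N d μ) :
    ∫ x, ‖f x‖ ^ 2 ≤ ν * Real.sqrt (∫ x, ‖Torus.laplacian f x‖ ^ 2) * Real.sqrt (Torus.ensembleEnergy μ) +
      C * Torus.ensembleEnergy μ := by
  obtain ⟨-, hzero⟩ := hstat 1 (fun _ => f) (MvPolynomial.X 0) (fun _ => hfb)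
    (by rw [MvPolynomial.totalDegree_X]; omega)
  simp only [polyGrad_X] at hzero
  exact force_sq_le_of_momentumRow hν hfb.1 hC h2 hzero

/-- Packaged for witnesses: `ε`-independent energy floor `‖f‖₂² ≤ ν‖Δf‖₂√E + C_f E` for every
`QuarticGate` witness whose (smooth, solenoidal, mean-zero) force is band-limited at the level. [folklore] -/
theorem IsQuarticWitness.force_sq_le {f : UnitAddTorus (Fin 3) → EuclideanSpace ℝ (Fin 3)} {ν : ℝ}
    (hν : 0 ≤ ν) {N : ℕ} (hfb : IsBandTest N f) {C : ℝ} (hC : ∀ x, ∑ i, ‖Torus.partialDeriv i f x‖ ≤ C)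
    {E ε : ℝ} {μ : Measure (Torus.energySpace (Fin 3))} (h : IsQuarticWitness f ν N E ε μ) :
    ∫ x, ‖f x‖ ^ 2 ≤ ν * Real.sqrt (∫ x, ‖Torus.laplacian f x‖ ^ 2) * Real.sqrt E + C * E := by
  obtain ⟨hprob, -, h4, hstat, hEn, -⟩ := h
  have h2 := integrable_norm_sq_of_norm_pow_four h4
  have hC0 : 0 ≤ C := le_trans (Finset.sum_nonneg fun i _ => norm_nonneg _) (hC 0)
  have hE0 : 0 ≤ Torus.ensembleEnergy μ := integral_nonneg fun u => by positivity
  have key := force_sq_le_of_polyStationary hν hfb hC h2 (by norm_num : 2 ≤ 4) hstat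
  calc ∫ x, ‖f x‖ ^ 2 ≤ _ := key
    _ ≤ ν * Real.sqrt (∫ x, ‖Torus.laplacian f x‖ ^ 2) * Real.sqrt E + C * E := by
        gcongr

end MomentumRow


/-! ## K. (cycle 2) THE SELECTION RULE behind accidental Casimirs, formally (vector algebra on `Fin 3 → ℝ`;
certified copy LANDED as `Negative/SelectionRule.lean`, p79020): equal-length pairs miss the
`(a−b)`-polarisation of `k = a+b` (`pair_transfer_orthogonal_sub`, `sub_dotProduct_add_eq_zero_of_eq_len`),
and only they do — the BLOCK-KILLING LEMMA `eq_zero_of_forall_pair_transfer` of §G. -/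

section SelectionRule

open Matrix

/-- BAC–CAB: `u × (v × w) = (u·w) v − (u·v) w`. [folklore] -/
theorem cross_cross_eq_sub (u v w : Fin 3 → ℝ) :
    u ⨯₃ (v ⨯₃ w) = (u ⬝ᵥ w) • v - (u ⬝ᵥ v) • w := by
  funext i
  fin_cases i <;> simp [cross_apply, vec3_dotProduct] <;> ring

/-- The pair transfer is orthogonal to `a − b` (for transverse amplitudes): `(a−b)·[(b·x)y + (a·y)x] = 0`
when `x ⊥ a`, `y ⊥ b`. [folklore] -/
theorem pair_transfer_orthogonal_sub (a b x y : Fin 3 → ℝ) (hx : x ⬝ᵥ a = 0) (hy : y ⬝ᵥ b = 0) :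
    (a - b) ⬝ᵥ ((b ⬝ᵥ x) • y + (a ⬝ᵥ y) • x) = 0 := by
  have hx' : a ⬝ᵥ x = 0 := by rw [dotProduct_comm]; exact hx
  have hy' : b ⬝ᵥ y = 0 := by rw [dotProduct_comm]; exact hy
  simp only [dotProduct_add, dotProduct_smul, sub_dotProduct, smul_eq_mul, hx', hy']
  ring

/-- **Equal lengths miss a polarisation.** If `|a| = |b|` then `a − b ⊥ a + b`, so `a − b` is a vector of
`(a+b)⊥` annihilating every pair transfer of the pair `(a,b)` (`pair_transfer_orthogonal_sub`): the
`(a−b)`-polarisation of the mode `k = a + b` receives nothing from this pair. [folklore] -/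
theorem sub_dotProduct_add_eq_zero_of_eq_len (a b : Fin 3 → ℝ) (h : a ⬝ᵥ a = b ⬝ᵥ b) :
    (a - b) ⬝ᵥ (a + b) = 0 := by
  simp only [sub_dotProduct, dotProduct_add, dotProduct_comm b a, h]
  ring

/-- A nonzero real 3-vector has positive self dot product. [folklore] -/
theorem dotProduct_self_pos_of_ne_zero {n : Fin 3 → ℝ} (hn : n ≠ 0) : 0 < n ⬝ᵥ n := by
  rw [vec3_dotProduct]
  by_contra hle
  push Not at hle
  have h0 : n 0 = 0 := by nlinarith [sq_nonneg (n 0), sq_nonneg (n 1), sq_nonneg (n 2)]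
  have h1 : n 1 = 0 := by nlinarith [sq_nonneg (n 0), sq_nonneg (n 1), sq_nonneg (n 2)]
  have h2 : n 2 = 0 := by nlinarith [sq_nonneg (n 0), sq_nonneg (n 1), sq_nonneg (n 2)]
  exact hn (funext fun i => by fin_cases i <;> assumption)

/-- **And nothing else does (block-killing lemma).** For `a × b ≠ 0` and `|a| ≠ |b|`, a vector
`v ⊥ a + b` annihilating every pair transfer `(b·x)y + (a·y)x` (`x ⊥ a`, `y ⊥ b`) vanishes — the pair
transfers of an unequal-length pair project ONTO `(a+b)⊥`. Used with `x, y ∈ {n, a×n, b×n}`, `n = a×b`: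
the transfers contain `|n|² n` and `|n|² (a−b)×n`, and `{a+b, n, (a−b)×n}` is a basis exactly when
`|n|²(|a|²−|b|²) ≠ 0`. [folklore] -/
theorem eq_zero_of_forall_pair_transfer (a b v : Fin 3 → ℝ) (hn : a ⨯₃ b ≠ 0)
    (hlen : a ⬝ᵥ a ≠ b ⬝ᵥ b) (hv : v ⬝ᵥ (a + b) = 0)
    (h : ∀ x y : Fin 3 → ℝ, x ⬝ᵥ a = 0 → y ⬝ᵥ b = 0 → v ⬝ᵥ ((b ⬝ᵥ x) • y + (a ⬝ᵥ y) • x) = 0) :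
    v = 0 := by
  set n : Fin 3 → ℝ := a ⨯₃ b with hndef
  have hN : 0 < n ⬝ᵥ n := dotProduct_self_pos_of_ne_zero hn
  -- orthogonality bookkeeping
  have hna : n ⬝ᵥ a = 0 := by rw [hndef, dotProduct_comm]; exact dot_self_cross a b
  have hnb : n ⬝ᵥ b = 0 := by rw [hndef, dotProduct_comm]; exact dot_cross_self a b
  have han : a ⬝ᵥ n = 0 := by rw [dotProduct_comm]; exact hna
  have hbn : b ⬝ᵥ n = 0 := by rw [dotProduct_comm]; exact hnb
  have hxa : (a ⨯₃ n) ⬝ᵥ a = 0 := by rw [dotProduct_comm]; exact dot_self_cross a n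
  have hyb : (b ⨯₃ n) ⬝ᵥ b = 0 := by rw [dotProduct_comm]; exact dot_self_cross b n
  -- triple products `a·(b×n) = n·n`, `b·(a×n) = −n·n`
  have habn : a ⬝ᵥ (b ⨯₃ n) = n ⬝ᵥ n := by
    rw [triple_product_permutation, triple_product_permutation, hndef]
  have hban : b ⬝ᵥ (a ⨯₃ n) = -(n ⬝ᵥ n) := by
    rw [triple_product_permutation, triple_product_permutation, hndef, ← cross_anticomm a b,
      dotProduct_neg]
  -- step 1: `x = n`, `y = b × n` gives `v·n = 0`
  have h1 := h n (b ⨯₃ n) hna hyb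
  rw [hbn, zero_smul, zero_add, habn, dotProduct_smul, smul_eq_mul] at h1
  have hvn : v ⬝ᵥ n = 0 := by
    rcases mul_eq_zero.1 h1 with h' | h'
    · exact absurd h' hN.ne'
    · exact h'
  -- step 2: `x = a × n`, `y = b × n` gives `v·((a−b)×n) = 0`
  have h2 := h (a ⨯₃ n) (b ⨯₃ n) hxa hyb
  rw [hban, habn, neg_smul, ← sub_eq_neg_add, ← smul_sub, dotProduct_smul, smul_eq_mul] at h2
  set w : Fin 3 → ℝ := a ⨯₃ n - b ⨯₃ n with hwdef
  have hw : w = (a - b) ⨯₃ n := by rw [hwdef, LinearMap.map_sub₂]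
  have hvw : v ⬝ᵥ w = 0 := by
    rcases mul_eq_zero.1 h2 with h' | h'
    · exact absurd h' hN.ne'
    · exact h'
  -- step 3: `{a+b, n, (a−b)×n}` is a basis: det = (n·n)(|a|²−|b|²) ≠ 0
  set M : Matrix (Fin 3) (Fin 3) ℝ := Matrix.of ![a + b, n, w] with hMdef
  have hdet : M.det = (n ⬝ᵥ n) * (a ⬝ᵥ a - b ⬝ᵥ b) := by
    rw [show M.det = Matrix.det ![a + b, n, w] from rfl, ← triple_product_eq_det, hw, cross_cross_eq_sub,
      dotProduct_sub, dotProduct_smul, dotProduct_smul, smul_eq_mul, smul_eq_mul]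
    have h3 : n ⬝ᵥ (a - b) = 0 := by rw [dotProduct_sub, hna, hnb, sub_zero]
    have h4 : (a + b) ⬝ᵥ (a - b) = a ⬝ᵥ a - b ⬝ᵥ b := by
      simp only [add_dotProduct, dotProduct_sub, dotProduct_comm b a]; ring
    have h5 : (a + b) ⬝ᵥ n = 0 := by rw [add_dotProduct, han, hbn, add_zero]
    rw [h3, h4, h5]
    ring
  have hdet0 : M.det ≠ 0 := by
    rw [hdet]
    exact mul_ne_zero hN.ne' (sub_ne_zero.2 hlen)
  have hv' : (a + b) ⬝ᵥ v = 0 := by rw [dotProduct_comm]; exact hv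
  have hvn' : n ⬝ᵥ v = 0 := by rw [dotProduct_comm]; exact hvn
  have hvw' : w ⬝ᵥ v = 0 := by rw [dotProduct_comm]; exact hvw
  have hMv : M *ᵥ v = 0 := by
    rw [hMdef, Matrix.cons_mulVec, Matrix.cons_mulVec, Matrix.cons_mulVec, Matrix.empty_mulVec,
      hv', hvn', hvw']
    simp
  exact Matrix.eq_zero_of_mulVec_eq_zero hdet0 hMv

end SelectionRule

end

end Summit.AnomalousDissipation.AnomalousDissipation.Cruxes.QuarticGate.Disproof
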